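import Literature.NumberTheory.GaloisRepresentations.AdequacyDegreeP
import Mathlib.FieldTheory.Finite.GaloisField
import Mathlib.NumberTheory.LegendreSymbol.QuadraticChar.Basic
import Mathlib.Algebra.CharP.Frobenius
import HarnessLib

/-!
# Alternative (c) of GHT Theorem 1.7 is necessary: `Ω₃(9) ≅ A₆ < GL₃(𝔽₉)` is not adequate

Topic `NumberTheory/GaloisRepresentations`; a sibling of `AdequacyDegreeP.lean` (the named fact
`ght2017_adequate_or_index_p_or_psl29` = Guralnick–Herzig–Tiep 2017, Thm 1.7: for a faithful
absolutely irreducible `σ : G → GL_p(k)`, `char k = p`, (a) `σ(G)` is adequate, or (b) `G` has an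
abelian normal subgroup of index `p`, or (c) `p = 3` and the image of `G` in `PGL₃` is
`PSL₂(9) ≅ A₆`).  The tree proves, classification-free, that (b) is a genuine exception
(`Subgroup.not_isExtendedAdequate_of_monomial_of_index_eq`, GHT Prop. 6.6) and everything about
(c) except that it occurs.  This file PROVES that alternative (c) cannot be dropped:

* `OmegaThreeNine.not_forall_adequate_or_comm_normal_index_three` — it is false that every
  faithful absolutely irreducible `σ : G → GL₃(k)`, `char k = 3`, `G` finite, satisfies (a) or (b);
* the counterexample is explicit: `H := ⟨x, y⟩ ≤ GL₃(𝔽₉)` with `x = Sym²(1 1; 0 1)`,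
  `y = Sym²(1 0; 1+i 1)` (`i² = -1`), the image `Ω₃(9) ≅ PSL₂(9) ≅ A₆` of `SL₂(9)` under the
  symmetric square (order `360`; this identification is explained but not used), and for it:
  `OmegaThreeNine.isAbsIrreducible` (the matrices of `H` span `M₃(k)`),
  `OmegaThreeNine.not_exists_comm_normal_index` (no abelian normal subgroup of index `3`: `xy`
  and `yx` have order `4` and do not commute), and `OmegaThreeNine.not_isExtendedAdequate` —
  clause (ii) fails: **`H¹(H, ad/Z) ≠ 0`**, an explicit `1`-cocycle `H → M₃(k)/k` which is not
  a coboundary.  GHT compute `dim H¹(PSL₂(9), ad/Z) = 1` for this module [Cor. 9.4 (b), via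
  [AJL] and the restriction to a Borel subgroup]; here only `≠ 0` is proved, for `H = ⟨x, y⟩` over
  any field of characteristic `3` containing `i`.

## The cocycle (where it comes from, and how it is verified)

`V = k³ = Sym²(k²) = L(2)` carries the `H`-invariant symmetric form `J` (the discriminant), so
`ad = End V ≅ V ⊗ V = S²V ⊕ Λ²V` and `ad/Z = S²V/kC ⊕ Λ²V` with `C ↔ 1` the invariant tensor.
As modules for `SL₂(9)`: `Λ²V ≅ V = L(2)`, and `S²V/kC` is a NON-split extension of `k` (top, the
contraction against `J`, which kills `C` since `dim V = 3 = 0`) by `L(4) = L(1) ⊗ L(1)⁽³⁾`.  The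
connecting map kills the class of this extension in `H¹(H, S²V/kC)`, but `H¹(SL₂(9), L(4))` is
`2`-dimensional: the second class is the same construction for the Frobenius TWIST
`V⁽³⁾ = L(2)⁽³⁾` — `S²V⁽³⁾/kC` is a non-split extension of `k` by `L(4)⁽³⁾ ≅ L(1)⁽³⁾ ⊗ L(1) ≅ L(4)`
— transported into `S²V/kC ⊂ ad/Z` along that isomorphism (a swap of tensor factors).
Concretely: `F(g) := P(g⁽³⁾ x₀ (g⁽³⁾)ᵀ − x₀) · J`, where `g⁽³⁾` is the entrywise cube (Frobenius
twist), `x₀ = E₁₁` is a symmetric tensor of contraction `1`, and `P` (`OmegaThreeNine.P`) is the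
`k`-linear map realising `L(4)⁽³⁾ ≅ L(4)` on tensors of contraction zero, modulo `k · J`; the
identity `F(gh) = g F(h) g⁻¹ + F(g) + μ · 1` (`OmegaThreeNine.Fl_mul`) follows formally from the
equivariance of `P` modulo `k · J`, which — being preserved under products — is checked on the two
generators only (`P_equivariant_x`, `P_equivariant_y`: identities between `3 × 3` matrices whose
entries are linear in a symbolic tensor `S`), and propagated along `H = ⟨x, y⟩` by closure
induction (`OmegaThreeNine.good_of_mem`; `x⁻¹ = x²`, `y⁻¹ = y²`).  That `g ↦ [F(g)]` is not a
coboundary is the inconsistency of the sixteen scalar coboundary equations at `x` and `y`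
(`OmegaThreeNine.key_not_coboundary`: a six-term linear combination of them reads `-1 - i = 0`).
All matrix identities are over `ℤ[i]` modulo `(3, i² + 1)` and are closed by `linear_combination`
with certificates `a · hS + b · hI + c · h3` (`hI : i² = -1`, `h3 : 3 = 0`) computed by machine
(polynomial division), entry by entry.

## References

* [GuralnickHerzigTiep2017] R. M. Guralnick, F. Herzig, P. H. Tiep, *Adequate subgroups and
  indecomposable modules*, J. Eur. Math. Soc. 19 (2017) 1231–1291 = arXiv:1405.0043, Theorem 1.7
  (c), Theorem 6.15 and its proof for `p = 3` (arXiv p. 24), Corollary 9.4 (b) (p. 34).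
* [Thorne2017TwoAdic] J. Thorne, Math. Z. 285 (2017), Def. 2.20 (the notion of adequacy).
-/

open scoped MatrixGroups Matrix

namespace Literature.NumberTheory.GaloisRepresentations

namespace OmegaThreeNine

variable {k : Type*} [Field k]

omit [Field k] in
/-- Two `3 × 3` matrices agree if their nine entries do. [folklore] -/
theorem mat3_eq {A B : Matrix (Fin 3) (Fin 3) k}
    (h00 : A 0 0 = B 0 0) (h01 : A 0 1 = B 0 1) (h02 : A 0 2 = B 0 2)
    (h10 : A 1 0 = B 1 0) (h11 : A 1 1 = B 1 1) (h12 : A 1 2 = B 1 2)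
    (h20 : A 2 0 = B 2 0) (h21 : A 2 1 = B 2 1) (h22 : A 2 2 = B 2 2) : A = B := by
  rw [Matrix.eta_fin_three A, Matrix.eta_fin_three B, h00, h01, h02, h10, h11, h12, h20, h21, h22]

section Defs

variable (I : k)

/-- `x = Sym²(1 1; 0 1)`: the image in `Ω₃ < GL₃` of an upper unipotent of `SL₂(9)`. [folklore] -/
def xM : Matrix (Fin 3) (Fin 3) k := !![1, 1, 1; 0, 1, -1; 0, 0, 1]
/-- `x⁻¹`. [folklore] -/
def xMinv : Matrix (Fin 3) (Fin 3) k := !![1, -1, 1; 0, 1, 1; 0, 0, 1]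
/-- `xᵀ`. [folklore] -/
def xMT : Matrix (Fin 3) (Fin 3) k := !![1, 0, 0; 1, 1, 0; 1, -1, 1]
/-- `y = Sym²(1 0; 1+i 1)`: the image of a lower unipotent of `SL₂(9)` (`i² = -1`). [folklore] -/
def yM : Matrix (Fin 3) (Fin 3) k := !![1, 0, 0; -1 - I, 1, 0; -I, 1 + I, 1]
/-- `y⁻¹`. [folklore] -/
def yMinv : Matrix (Fin 3) (Fin 3) k := !![1, 0, 0; 1 + I, 1, 0; -I, -1 - I, 1]
/-- `yᵀ`. [folklore] -/
def yMT : Matrix (Fin 3) (Fin 3) k := !![1, -1 - I, -I; 0, 1, 1 + I; 0, 0, 1]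
/-- `y⁽³⁾`: the Frobenius twist of `y` (Galois conjugate `i ↦ -i` of its entries). [folklore] -/
def y3M : Matrix (Fin 3) (Fin 3) k := !![1, 0, 0; -1 + I, 1, 0; I, 1 - I, 1]
/-- `(y⁽³⁾)ᵀ`. [folklore] -/
def y3MT : Matrix (Fin 3) (Fin 3) k := !![1, -1 + I, I; 0, 1, 1 - I; 0, 0, 1]
/-- The Gram matrix `J` of the invariant symmetric form of `Ω₃` (the discriminant of binary
quadratics), `J = J⁻¹`. [folklore] -/
def JM : Matrix (Fin 3) (Fin 3) k := !![0, 0, 1; 0, 1, 0; 1, 0, 0]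
/-- `x₀ = E₁₁`, a symmetric tensor of contraction `tr(x₀ J) = 1`. [folklore] -/
def x0M : Matrix (Fin 3) (Fin 3) k := !![0, 0, 0; 0, 1, 0; 0, 0, 0]
/-- The value `F(x)` of the cocycle at `x`. [folklore] -/
def FxM : Matrix (Fin 3) (Fin 3) k := !![0, 0, 1; 1, 0, 0; 0, 1, 0]
/-- The value `F(y)` of the cocycle at `y`. [folklore] -/
def FyM : Matrix (Fin 3) (Fin 3) k := !![0, 1 - I, 0; 0, 0, 1 - I; I, 0, 0]
/-- The intertwiner `P`: from symmetric tensors of the TWISTED module `V⁽³⁾ ⊗ V⁽³⁾` (coordinates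
`M₀₀, M₀₁ + M₁₀, M₁₂ + M₂₁, M₂₂` of `L(4)⁽³⁾ ≅ L(1)⁽³⁾ ⊗ L(1)`) to `V ⊗ V` (swapping the two
middle coordinates: `L(1)⁽³⁾ ⊗ L(1) ≅ L(1) ⊗ L(1)⁽³⁾ = L(4)`), found by solving the equivariance
equations by machine. [folklore] -/
def P (M : Matrix (Fin 3) (Fin 3) k) : Matrix (Fin 3) (Fin 3) k :=
  !![M 0 0, -(M 1 2 + M 2 1), 0; -(M 1 2 + M 2 1), 0, -(M 0 1 + M 1 0); 0, -(M 0 1 + M 1 0), M 2 2]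
/-- `x y` (an element of order `4`). [folklore] -/
def xyM : Matrix (Fin 3) (Fin 3) k := !![I, -1 + I, 1; -1, -I, -1; -I, 1 + I, 1]
/-- `y x` (an element of order `4`). [folklore] -/
def yxM : Matrix (Fin 3) (Fin 3) k := !![1, 1, 1; -1 - I, -I, 1 - I; -I, 1, I]
/-- `(x y)²`. [folklore] -/
def xy2M : Matrix (Fin 3) (Fin 3) k := !![I, 1 + I, -1; I, -1 + I, 1 + I; I, I, I]
/-- `(y x)²`. [folklore] -/
def yx2M : Matrix (Fin 3) (Fin 3) k := !![I, -1 - I, -1; -I, -1 + I, -1 - I; I, -I, I]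

end Defs

attribute [local simp] Matrix.mul_apply Fin.sum_univ_three frobenius_def Matrix.trace_fin_three
  xM xMinv xMT yM yMinv yMT y3M y3MT JM x0M FxM FyM P xyM yxM xy2M yx2M


/-! ### Generated explicit identities (certificates `a * hS + b * hI + c * h3` found by machine) -/

section Generated

variable (I : k)

/-- `x x⁻¹ = 1`. [folklore] -/
theorem xM_mul_xMinv [CharP k 3] :
    xM * xMinv = (1 : Matrix (Fin 3) (Fin 3) k) :=
  sub_eq_zero.mp <| by
    have h3 : (3 : k) = 0 := CharP.cast_eq_zero k 3
    refine mat3_eq ?_ ?_ ?_ ?_ ?_ ?_ ?_ ?_ ?_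
    · rw [Matrix.zero_apply]; conv_lhs => simp
    · rw [Matrix.zero_apply]; conv_lhs => simp
    · rw [Matrix.zero_apply]; conv_lhs => simp
      linear_combination ((1)) * h3
    · rw [Matrix.zero_apply]; conv_lhs => simp
    · rw [Matrix.zero_apply]; conv_lhs => simp
    · rw [Matrix.zero_apply]; conv_lhs => simp
    · rw [Matrix.zero_apply]; conv_lhs => simp
    · rw [Matrix.zero_apply]; conv_lhs => simp
    · rw [Matrix.zero_apply]; conv_lhs => simp

/-- `x⁻¹ x = 1`. [folklore] -/
theorem xMinv_mul_xM [CharP k 3] :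
    xMinv * xM = (1 : Matrix (Fin 3) (Fin 3) k) :=
  sub_eq_zero.mp <| by
    have h3 : (3 : k) = 0 := CharP.cast_eq_zero k 3
    refine mat3_eq ?_ ?_ ?_ ?_ ?_ ?_ ?_ ?_ ?_
    · rw [Matrix.zero_apply]; conv_lhs => simp
    · rw [Matrix.zero_apply]; conv_lhs => simp
    · rw [Matrix.zero_apply]; conv_lhs => simp
      linear_combination ((1)) * h3
    · rw [Matrix.zero_apply]; conv_lhs => simp
    · rw [Matrix.zero_apply]; conv_lhs => simp
    · rw [Matrix.zero_apply]; conv_lhs => simp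
    · rw [Matrix.zero_apply]; conv_lhs => simp
    · rw [Matrix.zero_apply]; conv_lhs => simp
    · rw [Matrix.zero_apply]; conv_lhs => simp

/-- `x³ = 1`. [folklore] -/
theorem xM_cube [CharP k 3] :
    xM * xM * xM = (1 : Matrix (Fin 3) (Fin 3) k) :=
  sub_eq_zero.mp <| by
    have h3 : (3 : k) = 0 := CharP.cast_eq_zero k 3
    refine mat3_eq ?_ ?_ ?_ ?_ ?_ ?_ ?_ ?_ ?_
    · rw [Matrix.zero_apply]; conv_lhs => simp
    · rw [Matrix.zero_apply]; conv_lhs => simp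
      linear_combination ((1)) * h3
    · rw [Matrix.zero_apply]; conv_lhs => simp
    · rw [Matrix.zero_apply]; conv_lhs => simp
    · rw [Matrix.zero_apply]; conv_lhs => simp
    · rw [Matrix.zero_apply]; conv_lhs => simp
      linear_combination ((-1)) * h3
    · rw [Matrix.zero_apply]; conv_lhs => simp
    · rw [Matrix.zero_apply]; conv_lhs => simp
    · rw [Matrix.zero_apply]; conv_lhs => simp

/-- The transpose of `x`. [folklore] -/
theorem xM_transpose  :
    (xM : Matrix (Fin 3) (Fin 3) k)ᵀ = xMT :=
  sub_eq_zero.mp <| by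
    refine mat3_eq ?_ ?_ ?_ ?_ ?_ ?_ ?_ ?_ ?_
    · rw [Matrix.zero_apply]; conv_lhs => simp
    · rw [Matrix.zero_apply]; conv_lhs => simp
    · rw [Matrix.zero_apply]; conv_lhs => simp
    · rw [Matrix.zero_apply]; conv_lhs => simp
    · rw [Matrix.zero_apply]; conv_lhs => simp
    · rw [Matrix.zero_apply]; conv_lhs => simp
    · rw [Matrix.zero_apply]; conv_lhs => simp
    · rw [Matrix.zero_apply]; conv_lhs => simp
    · rw [Matrix.zero_apply]; conv_lhs => simp

/-- `x` preserves the form `J`. [folklore] -/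
theorem xMT_J_xM [CharP k 3] :
    xMT * JM * xM = (JM : Matrix (Fin 3) (Fin 3) k) :=
  sub_eq_zero.mp <| by
    have h3 : (3 : k) = 0 := CharP.cast_eq_zero k 3
    refine mat3_eq ?_ ?_ ?_ ?_ ?_ ?_ ?_ ?_ ?_
    · rw [Matrix.zero_apply]; conv_lhs => simp
    · rw [Matrix.zero_apply]; conv_lhs => simp
    · rw [Matrix.zero_apply]; conv_lhs => simp
    · rw [Matrix.zero_apply]; conv_lhs => simp
    · rw [Matrix.zero_apply]; conv_lhs => simp
    · rw [Matrix.zero_apply]; conv_lhs => simp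
    · rw [Matrix.zero_apply]; conv_lhs => simp
    · rw [Matrix.zero_apply]; conv_lhs => simp
    · rw [Matrix.zero_apply]; conv_lhs => simp
      linear_combination ((1)) * h3

/-- `x J xᵀ = J`. [folklore] -/
theorem xM_J_xMT [CharP k 3] :
    xM * JM * xMT = (JM : Matrix (Fin 3) (Fin 3) k) :=
  sub_eq_zero.mp <| by
    have h3 : (3 : k) = 0 := CharP.cast_eq_zero k 3
    refine mat3_eq ?_ ?_ ?_ ?_ ?_ ?_ ?_ ?_ ?_
    · rw [Matrix.zero_apply]; conv_lhs => simp
      linear_combination ((1)) * h3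
    · rw [Matrix.zero_apply]; conv_lhs => simp
    · rw [Matrix.zero_apply]; conv_lhs => simp
    · rw [Matrix.zero_apply]; conv_lhs => simp
    · rw [Matrix.zero_apply]; conv_lhs => simp
    · rw [Matrix.zero_apply]; conv_lhs => simp
    · rw [Matrix.zero_apply]; conv_lhs => simp
    · rw [Matrix.zero_apply]; conv_lhs => simp
    · rw [Matrix.zero_apply]; conv_lhs => simp

/-- `x` has entries in `𝔽₃`: its Frobenius twist is itself. [folklore] -/
theorem xM_map_frobenius [CharP k 3] :
    (xM : Matrix (Fin 3) (Fin 3) k).map (frobenius k 3) = xM :=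
  sub_eq_zero.mp <| by
    refine mat3_eq ?_ ?_ ?_ ?_ ?_ ?_ ?_ ?_ ?_
    · rw [Matrix.zero_apply]; conv_lhs => simp
    · rw [Matrix.zero_apply]; conv_lhs => simp
    · rw [Matrix.zero_apply]; conv_lhs => simp
    · rw [Matrix.zero_apply]; conv_lhs => simp
    · rw [Matrix.zero_apply]; conv_lhs => simp
    · rw [Matrix.zero_apply]; conv_lhs => simp
      linear_combination
    · rw [Matrix.zero_apply]; conv_lhs => simp
    · rw [Matrix.zero_apply]; conv_lhs => simp
    · rw [Matrix.zero_apply]; conv_lhs => simp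

/-- `y y⁻¹ = 1`. [folklore] -/
theorem yM_mul_yMinv [CharP k 3] (hI : I ^ 2 = -1) :
    yM I * yMinv I = (1 : Matrix (Fin 3) (Fin 3) k) :=
  sub_eq_zero.mp <| by
    refine mat3_eq ?_ ?_ ?_ ?_ ?_ ?_ ?_ ?_ ?_
    · rw [Matrix.zero_apply]; conv_lhs => simp
    · rw [Matrix.zero_apply]; conv_lhs => simp
    · rw [Matrix.zero_apply]; conv_lhs => simp
    · rw [Matrix.zero_apply]; conv_lhs => simp
    · rw [Matrix.zero_apply]; conv_lhs => simp
    · rw [Matrix.zero_apply]; conv_lhs => simp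
    · rw [Matrix.zero_apply]; conv_lhs => simp
      linear_combination ((1)) * hI
    · rw [Matrix.zero_apply]; conv_lhs => simp
    · rw [Matrix.zero_apply]; conv_lhs => simp

/-- `y⁻¹ y = 1`. [folklore] -/
theorem yMinv_mul_yM [CharP k 3] (hI : I ^ 2 = -1) :
    yMinv I * yM I = (1 : Matrix (Fin 3) (Fin 3) k) :=
  sub_eq_zero.mp <| by
    refine mat3_eq ?_ ?_ ?_ ?_ ?_ ?_ ?_ ?_ ?_
    · rw [Matrix.zero_apply]; conv_lhs => simp
    · rw [Matrix.zero_apply]; conv_lhs => simp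
    · rw [Matrix.zero_apply]; conv_lhs => simp
    · rw [Matrix.zero_apply]; conv_lhs => simp
    · rw [Matrix.zero_apply]; conv_lhs => simp
    · rw [Matrix.zero_apply]; conv_lhs => simp
    · rw [Matrix.zero_apply]; conv_lhs => simp
      linear_combination ((1)) * hI
    · rw [Matrix.zero_apply]; conv_lhs => simp
    · rw [Matrix.zero_apply]; conv_lhs => simp

/-- `y³ = 1`. [folklore] -/
theorem yM_cube [CharP k 3] (hI : I ^ 2 = -1) :
    yM I * yM I * yM I = (1 : Matrix (Fin 3) (Fin 3) k) :=
  sub_eq_zero.mp <| by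
    have h3 : (3 : k) = 0 := CharP.cast_eq_zero k 3
    refine mat3_eq ?_ ?_ ?_ ?_ ?_ ?_ ?_ ?_ ?_
    · rw [Matrix.zero_apply]; conv_lhs => simp
    · rw [Matrix.zero_apply]; conv_lhs => simp
    · rw [Matrix.zero_apply]; conv_lhs => simp
    · rw [Matrix.zero_apply]; conv_lhs => simp
      linear_combination ((-1) + -(I)) * h3
    · rw [Matrix.zero_apply]; conv_lhs => simp
    · rw [Matrix.zero_apply]; conv_lhs => simp
    · rw [Matrix.zero_apply]; conv_lhs => simp
      linear_combination ((-3)) * hI + ((-3) * I) * h3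
    · rw [Matrix.zero_apply]; conv_lhs => simp
      linear_combination ((1) + I) * h3
    · rw [Matrix.zero_apply]; conv_lhs => simp

/-- The transpose of `y`. [folklore] -/
theorem yM_transpose  :
    (yM I)ᵀ = yMT I :=
  sub_eq_zero.mp <| by
    refine mat3_eq ?_ ?_ ?_ ?_ ?_ ?_ ?_ ?_ ?_
    · rw [Matrix.zero_apply]; conv_lhs => simp
    · rw [Matrix.zero_apply]; conv_lhs => simp
    · rw [Matrix.zero_apply]; conv_lhs => simp
    · rw [Matrix.zero_apply]; conv_lhs => simp
    · rw [Matrix.zero_apply]; conv_lhs => simp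
    · rw [Matrix.zero_apply]; conv_lhs => simp
    · rw [Matrix.zero_apply]; conv_lhs => simp
    · rw [Matrix.zero_apply]; conv_lhs => simp
    · rw [Matrix.zero_apply]; conv_lhs => simp

/-- `y` preserves the form `J`. [folklore] -/
theorem yMT_J_yM [CharP k 3] (hI : I ^ 2 = -1) :
    yMT I * JM * yM I = (JM : Matrix (Fin 3) (Fin 3) k) :=
  sub_eq_zero.mp <| by
    refine mat3_eq ?_ ?_ ?_ ?_ ?_ ?_ ?_ ?_ ?_
    · rw [Matrix.zero_apply]; conv_lhs => simp
      linear_combination ((1)) * hI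
    · rw [Matrix.zero_apply]; conv_lhs => simp
    · rw [Matrix.zero_apply]; conv_lhs => simp
    · rw [Matrix.zero_apply]; conv_lhs => simp
    · rw [Matrix.zero_apply]; conv_lhs => simp
    · rw [Matrix.zero_apply]; conv_lhs => simp
    · rw [Matrix.zero_apply]; conv_lhs => simp
    · rw [Matrix.zero_apply]; conv_lhs => simp
    · rw [Matrix.zero_apply]; conv_lhs => simp

/-- `y J yᵀ = J`. [folklore] -/
theorem yM_J_yMT [CharP k 3] (hI : I ^ 2 = -1) :
    yM I * JM * yMT I = (JM : Matrix (Fin 3) (Fin 3) k) :=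
  sub_eq_zero.mp <| by
    refine mat3_eq ?_ ?_ ?_ ?_ ?_ ?_ ?_ ?_ ?_
    · rw [Matrix.zero_apply]; conv_lhs => simp
    · rw [Matrix.zero_apply]; conv_lhs => simp
    · rw [Matrix.zero_apply]; conv_lhs => simp
    · rw [Matrix.zero_apply]; conv_lhs => simp
    · rw [Matrix.zero_apply]; conv_lhs => simp
    · rw [Matrix.zero_apply]; conv_lhs => simp
    · rw [Matrix.zero_apply]; conv_lhs => simp
    · rw [Matrix.zero_apply]; conv_lhs => simp
    · rw [Matrix.zero_apply]; conv_lhs => simp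
      linear_combination ((1)) * hI

/-- The Frobenius twist `y⁽³⁾` of `y` (entrywise cube, `I³ = -I`). [folklore] -/
theorem yM_map_frobenius [CharP k 3] (hI : I ^ 2 = -1) :
    (yM I).map (frobenius k 3) = y3M I :=
  sub_eq_zero.mp <| by
    have h3 : (3 : k) = 0 := CharP.cast_eq_zero k 3
    refine mat3_eq ?_ ?_ ?_ ?_ ?_ ?_ ?_ ?_ ?_
    · rw [Matrix.zero_apply]; conv_lhs => simp
    · rw [Matrix.zero_apply]; conv_lhs => simp
    · rw [Matrix.zero_apply]; conv_lhs => simp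
    · rw [Matrix.zero_apply]; conv_lhs => simp
      linear_combination ((-3) + -(I)) * hI + ((1) + -(I)) * h3
    · rw [Matrix.zero_apply]; conv_lhs => simp
    · rw [Matrix.zero_apply]; conv_lhs => simp
    · rw [Matrix.zero_apply]; conv_lhs => simp
      linear_combination (-(I)) * hI
    · rw [Matrix.zero_apply]; conv_lhs => simp
      linear_combination ((3) + I) * hI + ((-1) + I) * h3
    · rw [Matrix.zero_apply]; conv_lhs => simp

/-- The transpose of `y⁽³⁾`. [folklore] -/
theorem y3M_transpose  :
    (y3M I)ᵀ = y3MT I :=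
  sub_eq_zero.mp <| by
    refine mat3_eq ?_ ?_ ?_ ?_ ?_ ?_ ?_ ?_ ?_
    · rw [Matrix.zero_apply]; conv_lhs => simp
    · rw [Matrix.zero_apply]; conv_lhs => simp
    · rw [Matrix.zero_apply]; conv_lhs => simp
    · rw [Matrix.zero_apply]; conv_lhs => simp
    · rw [Matrix.zero_apply]; conv_lhs => simp
    · rw [Matrix.zero_apply]; conv_lhs => simp
    · rw [Matrix.zero_apply]; conv_lhs => simp
    · rw [Matrix.zero_apply]; conv_lhs => simp
    · rw [Matrix.zero_apply]; conv_lhs => simp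

/-- `y⁽³⁾` preserves the form `J`. [folklore] -/
theorem y3MT_J_y3M [CharP k 3] (hI : I ^ 2 = -1) :
    y3MT I * JM * y3M I = (JM : Matrix (Fin 3) (Fin 3) k) :=
  sub_eq_zero.mp <| by
    refine mat3_eq ?_ ?_ ?_ ?_ ?_ ?_ ?_ ?_ ?_
    · rw [Matrix.zero_apply]; conv_lhs => simp
      linear_combination ((1)) * hI
    · rw [Matrix.zero_apply]; conv_lhs => simp
    · rw [Matrix.zero_apply]; conv_lhs => simp
    · rw [Matrix.zero_apply]; conv_lhs => simp
    · rw [Matrix.zero_apply]; conv_lhs => simp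
    · rw [Matrix.zero_apply]; conv_lhs => simp
    · rw [Matrix.zero_apply]; conv_lhs => simp
    · rw [Matrix.zero_apply]; conv_lhs => simp
    · rw [Matrix.zero_apply]; conv_lhs => simp

/-- The value of the cocycle at `x`. [folklore] -/
theorem Fx_eq [CharP k 3] :
    P (xM * x0M * xMT - x0M) * JM = (FxM : Matrix (Fin 3) (Fin 3) k) :=
  sub_eq_zero.mp <| by
    have h3 : (3 : k) = 0 := CharP.cast_eq_zero k 3
    refine mat3_eq ?_ ?_ ?_ ?_ ?_ ?_ ?_ ?_ ?_
    · rw [Matrix.zero_apply]; conv_lhs => simp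
    · rw [Matrix.zero_apply]; conv_lhs => simp
    · rw [Matrix.zero_apply]; conv_lhs => simp
    · rw [Matrix.zero_apply]; conv_lhs => simp
      linear_combination ((-1)) * h3
    · rw [Matrix.zero_apply]; conv_lhs => simp
    · rw [Matrix.zero_apply]; conv_lhs => simp
    · rw [Matrix.zero_apply]; conv_lhs => simp
    · rw [Matrix.zero_apply]; conv_lhs => simp
      linear_combination ((-1)) * h3
    · rw [Matrix.zero_apply]; conv_lhs => simp

/-- The value of the cocycle at `y`. [folklore] -/
theorem Fy_eq [CharP k 3] (hI : I ^ 2 = -1) :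
    P (y3M I * x0M * y3MT I - x0M) * JM = FyM I :=
  sub_eq_zero.mp <| by
    have h3 : (3 : k) = 0 := CharP.cast_eq_zero k 3
    refine mat3_eq ?_ ?_ ?_ ?_ ?_ ?_ ?_ ?_ ?_
    · rw [Matrix.zero_apply]; conv_lhs => simp
    · rw [Matrix.zero_apply]; conv_lhs => simp
      linear_combination ((-1) + I) * h3
    · rw [Matrix.zero_apply]; conv_lhs => simp
    · rw [Matrix.zero_apply]; conv_lhs => simp
    · rw [Matrix.zero_apply]; conv_lhs => simp
    · rw [Matrix.zero_apply]; conv_lhs => simp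
      linear_combination ((-1) + I) * h3
    · rw [Matrix.zero_apply]; conv_lhs => simp
      linear_combination ((1)) * hI + (-(I)) * h3
    · rw [Matrix.zero_apply]; conv_lhs => simp
    · rw [Matrix.zero_apply]; conv_lhs => simp

/-- `P` intertwines the (twisted) action of `x` on symmetric tensors of contraction zero with conjugation, modulo `k · J`. [folklore] -/
theorem P_equivariant_x [CharP k 3] (S : Matrix (Fin 3) (Fin 3) k) (hS : S 0 2 + S 1 1 + S 2 0 = 0) :
    P (xM * S * xMT) = xM * P S * xMT + (S 0 1 + S 1 0 - S 2 2) • (JM : Matrix (Fin 3) (Fin 3) k) :=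
  sub_eq_zero.mp <| by
    have h3 : (3 : k) = 0 := CharP.cast_eq_zero k 3
    refine mat3_eq ?_ ?_ ?_ ?_ ?_ ?_ ?_ ?_ ?_
    · simp only [Matrix.zero_apply, Matrix.sub_apply, Matrix.add_apply, Matrix.smul_apply, Matrix.mul_apply, Fin.sum_univ_three, P, xM, xMT, JM, Matrix.of_apply, Matrix.cons_val', Matrix.cons_val_zero, Matrix.cons_val_one, Matrix.cons_val_two, Matrix.head_cons, Matrix.tail_cons, smul_eq_mul]
      linear_combination ((1)) * hS + (S 2 1 + S 1 2 + S 1 0 + S 0 1) * h3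
    · simp only [Matrix.zero_apply, Matrix.sub_apply, Matrix.add_apply, Matrix.smul_apply, Matrix.mul_apply, Fin.sum_univ_three, P, xM, xMT, JM, Matrix.of_apply, Matrix.cons_val', Matrix.cons_val_zero, Matrix.cons_val_one, Matrix.cons_val_two, Matrix.head_cons, Matrix.tail_cons, smul_eq_mul]
      linear_combination (S 2 2) * h3
    · simp only [Matrix.zero_apply, Matrix.sub_apply, Matrix.add_apply, Matrix.smul_apply, Matrix.mul_apply, Fin.sum_univ_three, P, xM, xMT, JM, Matrix.of_apply, Matrix.cons_val', Matrix.cons_val_zero, Matrix.cons_val_one, Matrix.cons_val_two, Matrix.head_cons, Matrix.tail_cons, smul_eq_mul]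
      linear_combination
    · simp only [Matrix.zero_apply, Matrix.sub_apply, Matrix.add_apply, Matrix.smul_apply, Matrix.mul_apply, Fin.sum_univ_three, P, xM, xMT, JM, Matrix.of_apply, Matrix.cons_val', Matrix.cons_val_zero, Matrix.cons_val_one, Matrix.cons_val_two, Matrix.head_cons, Matrix.tail_cons, smul_eq_mul]
      linear_combination (S 2 2) * h3
    · simp only [Matrix.zero_apply, Matrix.sub_apply, Matrix.add_apply, Matrix.smul_apply, Matrix.mul_apply, Fin.sum_univ_three, P, xM, xMT, JM, Matrix.of_apply, Matrix.cons_val', Matrix.cons_val_zero, Matrix.cons_val_one, Matrix.cons_val_two, Matrix.head_cons, Matrix.tail_cons, smul_eq_mul]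
      linear_combination (-(S 1 0) + -(S 0 1)) * h3
    · simp only [Matrix.zero_apply, Matrix.sub_apply, Matrix.add_apply, Matrix.smul_apply, Matrix.mul_apply, Fin.sum_univ_three, P, xM, xMT, JM, Matrix.of_apply, Matrix.cons_val', Matrix.cons_val_zero, Matrix.cons_val_one, Matrix.cons_val_two, Matrix.head_cons, Matrix.tail_cons, smul_eq_mul]
      linear_combination ((1)) * hS + (S 2 2 + -(S 1 1)) * h3
    · simp only [Matrix.zero_apply, Matrix.sub_apply, Matrix.add_apply, Matrix.smul_apply, Matrix.mul_apply, Fin.sum_univ_three, P, xM, xMT, JM, Matrix.of_apply, Matrix.cons_val', Matrix.cons_val_zero, Matrix.cons_val_one, Matrix.cons_val_two, Matrix.head_cons, Matrix.tail_cons, smul_eq_mul]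
      linear_combination
    · simp only [Matrix.zero_apply, Matrix.sub_apply, Matrix.add_apply, Matrix.smul_apply, Matrix.mul_apply, Fin.sum_univ_three, P, xM, xMT, JM, Matrix.of_apply, Matrix.cons_val', Matrix.cons_val_zero, Matrix.cons_val_one, Matrix.cons_val_two, Matrix.head_cons, Matrix.tail_cons, smul_eq_mul]
      linear_combination ((1)) * hS + (S 2 2 + -(S 1 1)) * h3
    · simp only [Matrix.zero_apply, Matrix.sub_apply, Matrix.add_apply, Matrix.smul_apply, Matrix.mul_apply, Fin.sum_univ_three, P, xM, xMT, JM, Matrix.of_apply, Matrix.cons_val', Matrix.cons_val_zero, Matrix.cons_val_one, Matrix.cons_val_two, Matrix.head_cons, Matrix.tail_cons, smul_eq_mul]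
      linear_combination

/-- `P` intertwines the Frobenius-twisted action of `y` with conjugation by `y`, modulo `k · J`, on tensors of contraction zero. [folklore] -/
theorem P_equivariant_y [CharP k 3] (hI : I ^ 2 = -1) (S : Matrix (Fin 3) (Fin 3) k) (hS : S 0 2 + S 1 1 + S 2 0 = 0) :
    P (y3M I * S * y3MT I) = yM I * P S * yMT I + (I * S 0 0 + (1 + I) * (S 1 2 + S 2 1)) • (JM : Matrix (Fin 3) (Fin 3) k) :=
  sub_eq_zero.mp <| by
    have h3 : (3 : k) = 0 := CharP.cast_eq_zero k 3
    refine mat3_eq ?_ ?_ ?_ ?_ ?_ ?_ ?_ ?_ ?_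
    · simp only [Matrix.zero_apply, Matrix.sub_apply, Matrix.add_apply, Matrix.smul_apply, Matrix.mul_apply, Fin.sum_univ_three, P, yM, yMT, y3M, y3MT, JM, Matrix.of_apply, Matrix.cons_val', Matrix.cons_val_zero, Matrix.cons_val_one, Matrix.cons_val_two, Matrix.head_cons, Matrix.tail_cons, smul_eq_mul]
      linear_combination
    · simp only [Matrix.zero_apply, Matrix.sub_apply, Matrix.add_apply, Matrix.smul_apply, Matrix.mul_apply, Fin.sum_univ_three, P, yM, yMT, y3M, y3MT, JM, Matrix.of_apply, Matrix.cons_val', Matrix.cons_val_zero, Matrix.cons_val_one, Matrix.cons_val_two, Matrix.head_cons, Matrix.tail_cons, smul_eq_mul]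
      linear_combination ((1) + -(I)) * hS + (S 1 0 + S 0 1 + (-2) * S 0 0) * hI + (-(S 1 1) + S 0 0 + I * S 1 1 + -(I * S 1 0) + -(I * S 0 1) + I * S 0 0) * h3
    · simp only [Matrix.zero_apply, Matrix.sub_apply, Matrix.add_apply, Matrix.smul_apply, Matrix.mul_apply, Fin.sum_univ_three, P, yM, yMT, y3M, y3MT, JM, Matrix.of_apply, Matrix.cons_val', Matrix.cons_val_zero, Matrix.cons_val_one, Matrix.cons_val_two, Matrix.head_cons, Matrix.tail_cons, smul_eq_mul]
      linear_combination
    · simp only [Matrix.zero_apply, Matrix.sub_apply, Matrix.add_apply, Matrix.smul_apply, Matrix.mul_apply, Fin.sum_univ_three, P, yM, yMT, y3M, y3MT, JM, Matrix.of_apply, Matrix.cons_val', Matrix.cons_val_zero, Matrix.cons_val_one, Matrix.cons_val_two, Matrix.head_cons, Matrix.tail_cons, smul_eq_mul]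
      linear_combination ((1) + -(I)) * hS + (S 1 0 + S 0 1 + (-2) * S 0 0) * hI + (-(S 1 1) + S 0 0 + I * S 1 1 + -(I * S 1 0) + -(I * S 0 1) + I * S 0 0) * h3
    · simp only [Matrix.zero_apply, Matrix.sub_apply, Matrix.add_apply, Matrix.smul_apply, Matrix.mul_apply, Fin.sum_univ_three, P, yM, yMT, y3M, y3MT, JM, Matrix.of_apply, Matrix.cons_val', Matrix.cons_val_zero, Matrix.cons_val_one, Matrix.cons_val_two, Matrix.head_cons, Matrix.tail_cons, smul_eq_mul]
      linear_combination (-(S 0 0)) * hI + (-(S 2 1) + -(S 1 2) + -(I * S 2 1) + -(I * S 1 2) + -(I * S 0 0)) * h3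
    · simp only [Matrix.zero_apply, Matrix.sub_apply, Matrix.add_apply, Matrix.smul_apply, Matrix.mul_apply, Fin.sum_univ_three, P, yM, yMT, y3M, y3MT, JM, Matrix.of_apply, Matrix.cons_val', Matrix.cons_val_zero, Matrix.cons_val_one, Matrix.cons_val_two, Matrix.head_cons, Matrix.tail_cons, smul_eq_mul]
      linear_combination (-(S 2 1) + -(S 1 2) + -(S 0 0)) * hI + (S 0 0 + -(I * S 2 1) + -(I * S 1 2) + -(I * S 0 0)) * h3
    · simp only [Matrix.zero_apply, Matrix.sub_apply, Matrix.add_apply, Matrix.smul_apply, Matrix.mul_apply, Fin.sum_univ_three, P, yM, yMT, y3M, y3MT, JM, Matrix.of_apply, Matrix.cons_val', Matrix.cons_val_zero, Matrix.cons_val_one, Matrix.cons_val_two, Matrix.head_cons, Matrix.tail_cons, smul_eq_mul]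
      linear_combination
    · simp only [Matrix.zero_apply, Matrix.sub_apply, Matrix.add_apply, Matrix.smul_apply, Matrix.mul_apply, Fin.sum_univ_three, P, yM, yMT, y3M, y3MT, JM, Matrix.of_apply, Matrix.cons_val', Matrix.cons_val_zero, Matrix.cons_val_one, Matrix.cons_val_two, Matrix.head_cons, Matrix.tail_cons, smul_eq_mul]
      linear_combination (-(S 2 1) + -(S 1 2) + -(S 0 0)) * hI + (S 0 0 + -(I * S 2 1) + -(I * S 1 2) + -(I * S 0 0)) * h3
    · simp only [Matrix.zero_apply, Matrix.sub_apply, Matrix.add_apply, Matrix.smul_apply, Matrix.mul_apply, Fin.sum_univ_three, P, yM, yMT, y3M, y3MT, JM, Matrix.of_apply, Matrix.cons_val', Matrix.cons_val_zero, Matrix.cons_val_one, Matrix.cons_val_two, Matrix.head_cons, Matrix.tail_cons, smul_eq_mul]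
      linear_combination (I) * hS + ((-2) * S 2 1 + (-2) * S 1 2 + S 1 1 + -(S 1 0) + -(S 0 1)) * hI + (S 2 1 + S 1 2 + S 1 0 + S 0 1 + -(I * S 2 1) + -(I * S 1 2) + -(I * S 1 1) + I * S 1 0 + I * S 0 1) * h3

/-- `x y`. [folklore] -/
theorem xM_mul_yM [CharP k 3] :
    xM * yM I = xyM I :=
  sub_eq_zero.mp <| by
    have h3 : (3 : k) = 0 := CharP.cast_eq_zero k 3
    refine mat3_eq ?_ ?_ ?_ ?_ ?_ ?_ ?_ ?_ ?_
    · rw [Matrix.zero_apply]; conv_lhs => simp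
      linear_combination (-(I)) * h3
    · rw [Matrix.zero_apply]; conv_lhs => simp
      linear_combination ((1)) * h3
    · rw [Matrix.zero_apply]; conv_lhs => simp
    · rw [Matrix.zero_apply]; conv_lhs => simp
    · rw [Matrix.zero_apply]; conv_lhs => simp
    · rw [Matrix.zero_apply]; conv_lhs => simp
    · rw [Matrix.zero_apply]; conv_lhs => simp
    · rw [Matrix.zero_apply]; conv_lhs => simp
    · rw [Matrix.zero_apply]; conv_lhs => simp

/-- `y x`. [folklore] -/
theorem yM_mul_xM [CharP k 3] :
    yM I * xM = yxM I :=
  sub_eq_zero.mp <| by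
    have h3 : (3 : k) = 0 := CharP.cast_eq_zero k 3
    refine mat3_eq ?_ ?_ ?_ ?_ ?_ ?_ ?_ ?_ ?_
    · rw [Matrix.zero_apply]; conv_lhs => simp
    · rw [Matrix.zero_apply]; conv_lhs => simp
    · rw [Matrix.zero_apply]; conv_lhs => simp
    · rw [Matrix.zero_apply]; conv_lhs => simp
    · rw [Matrix.zero_apply]; conv_lhs => simp
      linear_combination
    · rw [Matrix.zero_apply]; conv_lhs => simp
      linear_combination ((-1)) * h3
    · rw [Matrix.zero_apply]; conv_lhs => simp
    · rw [Matrix.zero_apply]; conv_lhs => simp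
    · rw [Matrix.zero_apply]; conv_lhs => simp
      linear_combination (-(I)) * h3

/-- `(x y)²`. [folklore] -/
theorem xyM_sq [CharP k 3] (hI : I ^ 2 = -1) :
    xyM I * xyM I = xy2M I :=
  sub_eq_zero.mp <| by
    have h3 : (3 : k) = 0 := CharP.cast_eq_zero k 3
    refine mat3_eq ?_ ?_ ?_ ?_ ?_ ?_ ?_ ?_ ?_
    · rw [Matrix.zero_apply]; conv_lhs => simp
      linear_combination ((1)) * hI + (-(I)) * h3
    · rw [Matrix.zero_apply]; conv_lhs => simp
      linear_combination
    · rw [Matrix.zero_apply]; conv_lhs => simp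
      linear_combination ((1)) * h3
    · rw [Matrix.zero_apply]; conv_lhs => simp
    · rw [Matrix.zero_apply]; conv_lhs => simp
      linear_combination ((1)) * hI + (-(I)) * h3
    · rw [Matrix.zero_apply]; conv_lhs => simp
      linear_combination ((-1)) * h3
    · rw [Matrix.zero_apply]; conv_lhs => simp
      linear_combination ((-1)) * hI + (-(I)) * h3
    · rw [Matrix.zero_apply]; conv_lhs => simp
      linear_combination ((-2)) * hI + ((1)) * h3
    · rw [Matrix.zero_apply]; conv_lhs => simp
      linear_combination (-(I)) * h3

/-- `(y x)²`. [folklore] -/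
theorem yxM_sq [CharP k 3] (hI : I ^ 2 = -1) :
    yxM I * yxM I = yx2M I :=
  sub_eq_zero.mp <| by
    have h3 : (3 : k) = 0 := CharP.cast_eq_zero k 3
    refine mat3_eq ?_ ?_ ?_ ?_ ?_ ?_ ?_ ?_ ?_
    · rw [Matrix.zero_apply]; conv_lhs => simp
      linear_combination (-(I)) * h3
    · rw [Matrix.zero_apply]; conv_lhs => simp
      linear_combination ((1)) * h3
    · rw [Matrix.zero_apply]; conv_lhs => simp
      linear_combination ((1)) * h3
    · rw [Matrix.zero_apply]; conv_lhs => simp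
      linear_combination ((2)) * hI + ((-1)) * h3
    · rw [Matrix.zero_apply]; conv_lhs => simp
      linear_combination ((1)) * hI + (-(I)) * h3
    · rw [Matrix.zero_apply]; conv_lhs => simp
      linear_combination
    · rw [Matrix.zero_apply]; conv_lhs => simp
      linear_combination ((-1)) * hI + (-(I)) * h3
    · rw [Matrix.zero_apply]; conv_lhs => simp
    · rw [Matrix.zero_apply]; conv_lhs => simp
      linear_combination ((1)) * hI + (-(I)) * h3

/-- `(x y)⁴ = 1`. [folklore] -/
theorem xy2M_sq [CharP k 3] (hI : I ^ 2 = -1) :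
    xy2M I * xy2M I = (1 : Matrix (Fin 3) (Fin 3) k) :=
  sub_eq_zero.mp <| by
    have h3 : (3 : k) = 0 := CharP.cast_eq_zero k 3
    refine mat3_eq ?_ ?_ ?_ ?_ ?_ ?_ ?_ ?_ ?_
    · rw [Matrix.zero_apply]; conv_lhs => simp
      linear_combination ((2)) * hI + ((-1)) * h3
    · rw [Matrix.zero_apply]; conv_lhs => simp
      linear_combination ((2)) * hI + ((-1)) * h3
    · rw [Matrix.zero_apply]; conv_lhs => simp
      linear_combination ((1)) * hI
    · rw [Matrix.zero_apply]; conv_lhs => simp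
      linear_combination ((3)) * hI + ((-1)) * h3
    · rw [Matrix.zero_apply]; conv_lhs => simp
      linear_combination ((3)) * hI + ((-1)) * h3
    · rw [Matrix.zero_apply]; conv_lhs => simp
      linear_combination ((2)) * hI + ((-1)) * h3
    · rw [Matrix.zero_apply]; conv_lhs => simp
      linear_combination ((3)) * hI + ((-1)) * h3
    · rw [Matrix.zero_apply]; conv_lhs => simp
      linear_combination ((3)) * hI + ((-1)) * h3
    · rw [Matrix.zero_apply]; conv_lhs => simp
      linear_combination ((2)) * hI + ((-1)) * h3

/-- `(y x)⁴ = 1`. [folklore] -/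
theorem yx2M_sq [CharP k 3] (hI : I ^ 2 = -1) :
    yx2M I * yx2M I = (1 : Matrix (Fin 3) (Fin 3) k) :=
  sub_eq_zero.mp <| by
    have h3 : (3 : k) = 0 := CharP.cast_eq_zero k 3
    refine mat3_eq ?_ ?_ ?_ ?_ ?_ ?_ ?_ ?_ ?_
    · rw [Matrix.zero_apply]; conv_lhs => simp
      linear_combination ((2)) * hI + ((-1)) * h3
    · rw [Matrix.zero_apply]; conv_lhs => simp
      linear_combination ((-2)) * hI + ((1)) * h3
    · rw [Matrix.zero_apply]; conv_lhs => simp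
      linear_combination ((1)) * hI
    · rw [Matrix.zero_apply]; conv_lhs => simp
      linear_combination ((-3)) * hI + ((1)) * h3
    · rw [Matrix.zero_apply]; conv_lhs => simp
      linear_combination ((3)) * hI + ((-1)) * h3
    · rw [Matrix.zero_apply]; conv_lhs => simp
      linear_combination ((-2)) * hI + ((1)) * h3
    · rw [Matrix.zero_apply]; conv_lhs => simp
      linear_combination ((3)) * hI + ((-1)) * h3
    · rw [Matrix.zero_apply]; conv_lhs => simp
      linear_combination ((-3)) * hI + ((1)) * h3
    · rw [Matrix.zero_apply]; conv_lhs => simp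
      linear_combination ((2)) * hI + ((-1)) * h3

/-- The matrix unit `E00` as a combination of elements of the group. [folklore] -/
theorem single_00_eq [CharP k 3] (hI : I ^ 2 = -1) :
    (!![((1)), 0, 0; 0, 0, 0; 0, 0, 0] : Matrix (Fin 3) (Fin 3) k) = (((-1) + -(I)) : k) • (xM * xM * xM) + (((-1)) : k) • (xM) + (((-1)) : k) • (yM I) + (((1) + I) : k) • (xM * xM) + (((1) + I) : k) • (xM * yM I) + (((1) + I) : k) • (yM I * xM) + (((1) + I) : k) • (yM I * yM I) + (((-1)) : k) • (xM * xM * yM I) + (((-1)) : k) • (xM * yM I * yM I) :=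
  sub_eq_zero.mp <| by
    have h3 : (3 : k) = 0 := CharP.cast_eq_zero k 3
    refine mat3_eq ?_ ?_ ?_ ?_ ?_ ?_ ?_ ?_ ?_
    · rw [Matrix.zero_apply]; conv_lhs => simp
      linear_combination ((1)) * hI + ((-1) + (-3) * I) * h3
    · rw [Matrix.zero_apply]; conv_lhs => simp
      linear_combination ((-1)) * hI + ((2)) * h3
    · rw [Matrix.zero_apply]; conv_lhs => simp
      linear_combination (-(I)) * h3
    · rw [Matrix.zero_apply]; conv_lhs => simp
      linear_combination ((4)) * hI + ((-1) + (3) * I) * h3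
    · rw [Matrix.zero_apply]; conv_lhs => simp
      linear_combination ((2)) * hI + ((-1) + -(I)) * h3
    · rw [Matrix.zero_apply]; conv_lhs => simp
      linear_combination ((1)) * hI + ((-1) + I) * h3
    · rw [Matrix.zero_apply]; conv_lhs => simp
      linear_combination ((6) + I) * hI + ((-2)) * h3
    · rw [Matrix.zero_apply]; conv_lhs => simp
      linear_combination ((-3)) * hI + ((1) + -(I)) * h3
    · rw [Matrix.zero_apply]; conv_lhs => simp
      linear_combination ((2)) * hI

/-- The matrix unit `E01` as a combination of elements of the group. [folklore] -/
theorem single_01_eq [CharP k 3] (hI : I ^ 2 = -1) :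
    (!![0, ((1)), 0; 0, 0, 0; 0, 0, 0] : Matrix (Fin 3) (Fin 3) k) = (((-1)) : k) • (xM * xM * xM) + ((-(I)) : k) • (xM) + (((-1)) : k) • (yM I) + (((-1) + -(I)) : k) • (xM * xM) + (((1)) : k) • (xM * yM I) + ((I) : k) • (yM I * xM) + ((I) : k) • (yM I * yM I) + (((-1)) : k) • (xM * xM * yM I) + (((1) + I) : k) • (xM * yM I * yM I) :=
  sub_eq_zero.mp <| by
    have h3 : (3 : k) = 0 := CharP.cast_eq_zero k 3
    refine mat3_eq ?_ ?_ ?_ ?_ ?_ ?_ ?_ ?_ ?_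
    · rw [Matrix.zero_apply]; conv_lhs => simp
      linear_combination ((7) + I) * hI + ((-1) + (2) * I) * h3
    · rw [Matrix.zero_apply]; conv_lhs => simp
      linear_combination ((-2)) * hI + ((2) + -(I)) * h3
    · rw [Matrix.zero_apply]; conv_lhs => simp
      linear_combination
    · rw [Matrix.zero_apply]; conv_lhs => simp
      linear_combination (-(I)) * hI + (I) * h3
    · rw [Matrix.zero_apply]; conv_lhs => simp
      linear_combination ((3)) * hI + (I) * h3
    · rw [Matrix.zero_apply]; conv_lhs => simp
      linear_combination ((1)) * hI + ((-2)) * h3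
    · rw [Matrix.zero_apply]; conv_lhs => simp
      linear_combination ((10) + (2) * I) * hI + ((-3) + I) * h3
    · rw [Matrix.zero_apply]; conv_lhs => simp
      linear_combination ((-4)) * hI + ((1) + (-2) * I) * h3
    · rw [Matrix.zero_apply]; conv_lhs => simp
      linear_combination ((2)) * hI

/-- The matrix unit `E02` as a combination of elements of the group. [folklore] -/
theorem single_02_eq [CharP k 3] :
    (!![0, 0, ((1)); 0, 0, 0; 0, 0, 0] : Matrix (Fin 3) (Fin 3) k) = (((-1)) : k) • (xM * xM * xM) + (((-1)) : k) • (xM) + (((-1)) : k) • (xM * xM) :=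
  sub_eq_zero.mp <| by
    have h3 : (3 : k) = 0 := CharP.cast_eq_zero k 3
    refine mat3_eq ?_ ?_ ?_ ?_ ?_ ?_ ?_ ?_ ?_
    · rw [Matrix.zero_apply]; conv_lhs => simp
      linear_combination ((1)) * h3
    · rw [Matrix.zero_apply]; conv_lhs => simp
      linear_combination ((2)) * h3
    · rw [Matrix.zero_apply]; conv_lhs => simp
      linear_combination ((1)) * h3
    · rw [Matrix.zero_apply]; conv_lhs => simp
    · rw [Matrix.zero_apply]; conv_lhs => simp
      linear_combination ((1)) * h3
    · rw [Matrix.zero_apply]; conv_lhs => simp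
      linear_combination ((-2)) * h3
    · rw [Matrix.zero_apply]; conv_lhs => simp
    · rw [Matrix.zero_apply]; conv_lhs => simp
    · rw [Matrix.zero_apply]; conv_lhs => simp
      linear_combination ((1)) * h3

/-- The matrix unit `E10` as a combination of elements of the group. [folklore] -/
theorem single_10_eq [CharP k 3] (hI : I ^ 2 = -1) :
    (!![0, 0, 0; ((1)), 0, 0; 0, 0, 0] : Matrix (Fin 3) (Fin 3) k) = (((-1) + I) : k) • (xM * xM * xM) + (((-1) + I) : k) • (xM) + (((-1) + -(I)) : k) • (yM I) + (((1) + I) : k) • (xM * xM) + (((1) + -(I)) : k) • (xM * yM I) + (((1) + I) : k) • (yM I * xM) + (((1)) : k) • (yM I * yM I) + (((-1)) : k) • (xM * xM * yM I) + (((-1) + I) : k) • (xM * yM I * yM I) :=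
  sub_eq_zero.mp <| by
    have h3 : (3 : k) = 0 := CharP.cast_eq_zero k 3
    refine mat3_eq ?_ ?_ ?_ ?_ ?_ ?_ ?_ ?_ ?_
    · rw [Matrix.zero_apply]; conv_lhs => simp
      linear_combination ((3) + I) * hI + ((-2) + (-3) * I) * h3
    · rw [Matrix.zero_apply]; conv_lhs => simp
      linear_combination ((-1)) * hI + ((2) + (-2) * I) * h3
    · rw [Matrix.zero_apply]; conv_lhs => simp
      linear_combination (-(I)) * h3
    · rw [Matrix.zero_apply]; conv_lhs => simp
      linear_combination ((-1) + -(I)) * hI + ((1) + (2) * I) * h3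
    · rw [Matrix.zero_apply]; conv_lhs => simp
      linear_combination ((2)) * hI + ((-1) + -(I)) * h3
    · rw [Matrix.zero_apply]; conv_lhs => simp
      linear_combination ((1)) * hI + ((-1) + (3) * I) * h3
    · rw [Matrix.zero_apply]; conv_lhs => simp
      linear_combination ((3) + I) * hI + ((-1)) * h3
    · rw [Matrix.zero_apply]; conv_lhs => simp
      linear_combination
    · rw [Matrix.zero_apply]; conv_lhs => simp
      linear_combination ((2)) * hI

/-- The matrix unit `E11` as a combination of elements of the group. [folklore] -/
theorem single_11_eq [CharP k 3] (hI : I ^ 2 = -1) :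
    (!![0, 0, 0; 0, ((1)), 0; 0, 0, 0] : Matrix (Fin 3) (Fin 3) k) = ((I) : k) • (xM * xM * xM) + (((1) + -(I)) : k) • (xM) + (((1) + -(I)) : k) • (yM I) + (((1) + I) : k) • (xM * xM) + (((-1)) : k) • (xM * yM I) + (((-1)) : k) • (yM I * xM) + (((1) + I) : k) • (yM I * yM I) :=
  sub_eq_zero.mp <| by
    have h3 : (3 : k) = 0 := CharP.cast_eq_zero k 3
    refine mat3_eq ?_ ?_ ?_ ?_ ?_ ?_ ?_ ?_ ?_
    · rw [Matrix.zero_apply]; conv_lhs => simp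
      linear_combination ((-1) + -(I)) * h3
    · rw [Matrix.zero_apply]; conv_lhs => simp
      linear_combination (-(I)) * h3
    · rw [Matrix.zero_apply]; conv_lhs => simp
      linear_combination
    · rw [Matrix.zero_apply]; conv_lhs => simp
      linear_combination ((1)) * hI + (I) * h3
    · rw [Matrix.zero_apply]; conv_lhs => simp
      linear_combination ((-1) + -(I)) * h3
    · rw [Matrix.zero_apply]; conv_lhs => simp
      linear_combination (I) * h3
    · rw [Matrix.zero_apply]; conv_lhs => simp
      linear_combination ((4) + I) * hI + ((-1) + I) * h3
    · rw [Matrix.zero_apply]; conv_lhs => simp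
      linear_combination ((-1)) * hI + (-(I)) * h3
    · rw [Matrix.zero_apply]; conv_lhs => simp
      linear_combination ((-1) + -(I)) * h3

/-- The matrix unit `E12` as a combination of elements of the group. [folklore] -/
theorem single_12_eq [CharP k 3] (hI : I ^ 2 = -1) :
    (!![0, 0, 0; 0, 0, ((1)); 0, 0, 0] : Matrix (Fin 3) (Fin 3) k) = (((-1)) : k) • (xM * xM * xM) + (((1) + -(I)) : k) • (xM) + (((-1)) : k) • (yM I) + (((1) + -(I)) : k) • (xM * xM) + (((1)) : k) • (xM * yM I) + ((I) : k) • (yM I * xM) + ((I) : k) • (yM I * yM I) + (((-1)) : k) • (xM * xM * yM I) + (((1) + I) : k) • (xM * yM I * yM I) :=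
  sub_eq_zero.mp <| by
    have h3 : (3 : k) = 0 := CharP.cast_eq_zero k 3
    refine mat3_eq ?_ ?_ ?_ ?_ ?_ ?_ ?_ ?_ ?_
    · rw [Matrix.zero_apply]; conv_lhs => simp
      linear_combination ((7) + I) * hI + ((-2) + (2) * I) * h3
    · rw [Matrix.zero_apply]; conv_lhs => simp
      linear_combination ((-2)) * hI + (-(I)) * h3
    · rw [Matrix.zero_apply]; conv_lhs => simp
      linear_combination ((-1)) * h3
    · rw [Matrix.zero_apply]; conv_lhs => simp
      linear_combination (-(I)) * hI + (I) * h3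
    · rw [Matrix.zero_apply]; conv_lhs => simp
      linear_combination ((3)) * hI + ((-1) + I) * h3
    · rw [Matrix.zero_apply]; conv_lhs => simp
      linear_combination ((1)) * hI
    · rw [Matrix.zero_apply]; conv_lhs => simp
      linear_combination ((10) + (2) * I) * hI + ((-3) + I) * h3
    · rw [Matrix.zero_apply]; conv_lhs => simp
      linear_combination ((-4)) * hI + ((1) + (-2) * I) * h3
    · rw [Matrix.zero_apply]; conv_lhs => simp
      linear_combination ((2)) * hI + ((-1)) * h3

/-- The matrix unit `E20` as a combination of elements of the group. [folklore] -/
theorem single_20_eq [CharP k 3] (hI : I ^ 2 = -1) :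
    (!![0, 0, 0; 0, 0, 0; ((1)), 0, 0] : Matrix (Fin 3) (Fin 3) k) = ((-(I)) : k) • (xM * xM * xM) + ((-(I)) : k) • (yM I) + ((-(I)) : k) • (yM I * yM I) :=
  sub_eq_zero.mp <| by
    have h3 : (3 : k) = 0 := CharP.cast_eq_zero k 3
    refine mat3_eq ?_ ?_ ?_ ?_ ?_ ?_ ?_ ?_ ?_
    · rw [Matrix.zero_apply]; conv_lhs => simp
      linear_combination (I) * h3
    · rw [Matrix.zero_apply]; conv_lhs => simp
      linear_combination (I) * h3
    · rw [Matrix.zero_apply]; conv_lhs => simp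
    · rw [Matrix.zero_apply]; conv_lhs => simp
      linear_combination ((-3)) * hI + ((1) + -(I)) * h3
    · rw [Matrix.zero_apply]; conv_lhs => simp
      linear_combination (I) * h3
    · rw [Matrix.zero_apply]; conv_lhs => simp
      linear_combination (-(I)) * h3
    · rw [Matrix.zero_apply]; conv_lhs => simp
      linear_combination ((-5) + -(I)) * hI + ((2)) * h3
    · rw [Matrix.zero_apply]; conv_lhs => simp
      linear_combination ((3)) * hI + ((-1) + I) * h3
    · rw [Matrix.zero_apply]; conv_lhs => simp
      linear_combination (I) * h3

/-- The matrix unit `E21` as a combination of elements of the group. [folklore] -/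
theorem single_21_eq [CharP k 3] (hI : I ^ 2 = -1) :
    (!![0, 0, 0; 0, 0, 0; 0, ((1)), 0] : Matrix (Fin 3) (Fin 3) k) = (((-1) + I) : k) • (xM * xM * xM) + (((-1) + I) : k) • (xM) + ((I) : k) • (yM I) + (((1) + I) : k) • (xM * xM) + (((1) + -(I)) : k) • (xM * yM I) + (((1) + I) : k) • (yM I * xM) + ((I) : k) • (yM I * yM I) + (((-1)) : k) • (xM * xM * yM I) + (((-1) + I) : k) • (xM * yM I * yM I) :=
  sub_eq_zero.mp <| by
    have h3 : (3 : k) = 0 := CharP.cast_eq_zero k 3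
    refine mat3_eq ?_ ?_ ?_ ?_ ?_ ?_ ?_ ?_ ?_
    · rw [Matrix.zero_apply]; conv_lhs => simp
      linear_combination ((3) + I) * hI + ((-2) + (-4) * I) * h3
    · rw [Matrix.zero_apply]; conv_lhs => simp
      linear_combination ((-1)) * hI + ((2) + (-2) * I) * h3
    · rw [Matrix.zero_apply]; conv_lhs => simp
      linear_combination (-(I)) * h3
    · rw [Matrix.zero_apply]; conv_lhs => simp
      linear_combination ((3) + -(I)) * hI + ((-1) + (3) * I) * h3
    · rw [Matrix.zero_apply]; conv_lhs => simp
      linear_combination ((2)) * hI + ((-1) + (-2) * I) * h3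
    · rw [Matrix.zero_apply]; conv_lhs => simp
      linear_combination ((1)) * hI + ((-1) + (3) * I) * h3
    · rw [Matrix.zero_apply]; conv_lhs => simp
      linear_combination ((8) + (2) * I) * hI + ((-3) + -(I)) * h3
    · rw [Matrix.zero_apply]; conv_lhs => simp
      linear_combination ((-4)) * hI + ((2) + -(I)) * h3
    · rw [Matrix.zero_apply]; conv_lhs => simp
      linear_combination ((2)) * hI + (-(I)) * h3

/-- The matrix unit `E22` as a combination of elements of the group. [folklore] -/
theorem single_22_eq [CharP k 3] (hI : I ^ 2 = -1) :
    (!![0, 0, 0; 0, 0, 0; 0, 0, ((1))] : Matrix (Fin 3) (Fin 3) k) = (((-1)) : k) • (xM * xM * xM) + ((I) : k) • (xM) + ((I) : k) • (yM I) + (((1) + I) : k) • (xM * xM) + ((-(I)) : k) • (xM * yM I) + ((-(I)) : k) • (yM I * xM) + (((1) + I) : k) • (yM I * yM I) + (((1)) : k) • (xM * xM * yM I) + (((1)) : k) • (xM * yM I * yM I) :=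
  sub_eq_zero.mp <| by
    have h3 : (3 : k) = 0 := CharP.cast_eq_zero k 3
    refine mat3_eq ?_ ?_ ?_ ?_ ?_ ?_ ?_ ?_ ?_
    · rw [Matrix.zero_apply]; conv_lhs => simp
      linear_combination ((-1)) * hI + ((1) + (2) * I) * h3
    · rw [Matrix.zero_apply]; conv_lhs => simp
      linear_combination ((1)) * hI + ((-2) + -(I)) * h3
    · rw [Matrix.zero_apply]; conv_lhs => simp
      linear_combination ((-1)) * h3
    · rw [Matrix.zero_apply]; conv_lhs => simp
      linear_combination ((1)) * hI + ((1)) * h3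
    · rw [Matrix.zero_apply]; conv_lhs => simp
      linear_combination ((-2)) * hI + ((1)) * h3
    · rw [Matrix.zero_apply]; conv_lhs => simp
      linear_combination ((-1)) * hI + ((1)) * h3
    · rw [Matrix.zero_apply]; conv_lhs => simp
      linear_combination ((5) + I) * hI + ((-1) + (3) * I) * h3
    · rw [Matrix.zero_apply]; conv_lhs => simp
      linear_combination ((-2)) * hI + ((-1) + (-2) * I) * h3
    · rw [Matrix.zero_apply]; conv_lhs => simp
      linear_combination ((-2)) * hI + (-(I)) * h3

/-- `J² = 1`. [folklore] -/
theorem JM_mul_JM  :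
    JM * JM = (1 : Matrix (Fin 3) (Fin 3) k) :=
  sub_eq_zero.mp <| by
    refine mat3_eq ?_ ?_ ?_ ?_ ?_ ?_ ?_ ?_ ?_
    · rw [Matrix.zero_apply]; conv_lhs => simp
    · rw [Matrix.zero_apply]; conv_lhs => simp
    · rw [Matrix.zero_apply]; conv_lhs => simp
    · rw [Matrix.zero_apply]; conv_lhs => simp
    · rw [Matrix.zero_apply]; conv_lhs => simp
    · rw [Matrix.zero_apply]; conv_lhs => simp
    · rw [Matrix.zero_apply]; conv_lhs => simp
    · rw [Matrix.zero_apply]; conv_lhs => simp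
    · rw [Matrix.zero_apply]; conv_lhs => simp

/-- `x y` and `y x` do not commute: comparing the `(0,1)` entries of `(xy)(yx)` and `(yx)(xy)` gives
`2 = 0`. [folklore] -/
theorem two_eq_zero_of_xyM_comm [CharP k 3] (hI : I ^ 2 = -1)
    (h : xyM I * yxM I = yxM I * xyM I) : (2 : k) = 0 := by
  have h3 : (3 : k) = 0 := CharP.cast_eq_zero k 3
  have e := congrFun (congrFun h 0) 1
  simp only [Matrix.mul_apply, Fin.sum_univ_three, xyM, yxM, Matrix.of_apply, Matrix.cons_val', Matrix.cons_val_zero, Matrix.cons_val_one, Matrix.cons_val_two, Matrix.head_cons, Matrix.tail_cons] at e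
  linear_combination ((-1) + -(I)) * e + (-(I)) * hI + ((1) + I) * h3

/-- **The cocycle is not a coboundary**: the coboundary equations at the two generators are
inconsistent (a machine-found linear combination of six of their entries reads `((-1) + -(I)) = 0`). [folklore] -/
theorem key_not_coboundary [CharP k 3] (hI : I ^ 2 = -1) (Mt : Matrix (Fin 3) (Fin 3) k) (c₁ c₂ : k)
    (h1 : c₁ • (1 : Matrix (Fin 3) (Fin 3) k) = FxM - (xM * Mt * xMinv - Mt))
    (h2 : c₂ • (1 : Matrix (Fin 3) (Fin 3) k) = FyM I - (yM I * Mt * yMinv I - Mt)) :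
    (((-1) + -(I)) : k) = 0 := by
  have h3 : (3 : k) = 0 := CharP.cast_eq_zero k 3
  rw [Matrix.one_fin_three] at h1 h2
  have ex01 := congrFun (congrFun h1 0) 1
  simp only [Matrix.sub_apply, Matrix.smul_apply, Matrix.mul_apply, Fin.sum_univ_three, xM, xMinv, FxM, Matrix.of_apply, Matrix.cons_val', Matrix.cons_val_zero, Matrix.cons_val_one, Matrix.cons_val_two, Matrix.head_cons, Matrix.tail_cons, smul_eq_mul] at ex01
  have ex10 := congrFun (congrFun h1 1) 0
  simp only [Matrix.sub_apply, Matrix.smul_apply, Matrix.mul_apply, Fin.sum_univ_three, xM, xMinv, FxM, Matrix.of_apply, Matrix.cons_val', Matrix.cons_val_zero, Matrix.cons_val_one, Matrix.cons_val_two, Matrix.head_cons, Matrix.tail_cons, smul_eq_mul] at ex10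
  have ex12 := congrFun (congrFun h1 1) 2
  simp only [Matrix.sub_apply, Matrix.smul_apply, Matrix.mul_apply, Fin.sum_univ_three, xM, xMinv, FxM, Matrix.of_apply, Matrix.cons_val', Matrix.cons_val_zero, Matrix.cons_val_one, Matrix.cons_val_two, Matrix.head_cons, Matrix.tail_cons, smul_eq_mul] at ex12
  have ey01 := congrFun (congrFun h2 0) 1
  simp only [Matrix.sub_apply, Matrix.smul_apply, Matrix.mul_apply, Fin.sum_univ_three, yM, yMinv, FyM, Matrix.of_apply, Matrix.cons_val', Matrix.cons_val_zero, Matrix.cons_val_one, Matrix.cons_val_two, Matrix.head_cons, Matrix.tail_cons, smul_eq_mul] at ey01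
  have ey10 := congrFun (congrFun h2 1) 0
  simp only [Matrix.sub_apply, Matrix.smul_apply, Matrix.mul_apply, Fin.sum_univ_three, yM, yMinv, FyM, Matrix.of_apply, Matrix.cons_val', Matrix.cons_val_zero, Matrix.cons_val_one, Matrix.cons_val_two, Matrix.head_cons, Matrix.tail_cons, smul_eq_mul] at ey10
  have ey21 := congrFun (congrFun h2 2) 1
  simp only [Matrix.sub_apply, Matrix.smul_apply, Matrix.mul_apply, Fin.sum_univ_three, yM, yMinv, FyM, Matrix.of_apply, Matrix.cons_val', Matrix.cons_val_zero, Matrix.cons_val_one, Matrix.cons_val_two, Matrix.head_cons, Matrix.tail_cons, smul_eq_mul] at ey21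
  linear_combination ((-1) + -(I)) * ex01 + ((-1) + -(I)) * ex10 + ((-1) + -(I)) * ex12 + (-(I)) * ey01 + ((1)) * ey10 + ((1)) * ey21 + ((1) + Mt 1 2 + (-3) * Mt 0 2 + Mt 0 1) * hI + ((-1) + -(Mt 2 0) + Mt 0 2 + -(I) + -(I * Mt 2 0) + I * Mt 1 2 + -(I * Mt 0 2) + I * Mt 0 1) * h3

end Generated
/-! ### The group `H = ⟨x, y⟩ ≤ GL₃(k)` and the form `J` -/

section Group

variable [CharP k 3] {I : k} (hI : I ^ 2 = -1)

/-- `x ∈ GL₃(k)`. [folklore] -/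
def x : GL (Fin 3) k := ⟨xM, xMinv, xM_mul_xMinv, xMinv_mul_xM⟩

/-- `y ∈ GL₃(k)` (for `I² = -1`). [folklore] -/
def y : GL (Fin 3) k := ⟨yM I, yMinv I, yM_mul_yMinv I hI, yMinv_mul_yM I hI⟩

/-- **The group `H := ⟨x, y⟩ ≤ GL₃(k)`** — over `𝔽₉ = 𝔽₃(i)` this is `Ω₃(9) ≅ PSL₂(9) ≅ A₆` (the
image of `SL₂(9)` under the symmetric square), of order `360`; only `H = ⟨x, y⟩` is used below.
[folklore] -/
def H : Subgroup (GL (Fin 3) k) := Subgroup.closure {x, y hI}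

omit [CharP k 3] in
/-- `tr(S J) = S₀₂ + S₁₁ + S₂₀` — the contraction against the form. [folklore] -/
theorem csum_eq_trace (S : Matrix (Fin 3) (Fin 3) k) :
    S 0 2 + S 1 1 + S 2 0 = Matrix.trace (S * JM) := by
  rw [Matrix.trace_fin_three]
  simp only [JM, Matrix.mul_apply, Fin.sum_univ_three, Matrix.of_apply, Matrix.cons_val',
    Matrix.cons_val_zero, Matrix.cons_val_one, Matrix.cons_val_two, Matrix.head_cons,
    Matrix.tail_cons]
  ring

omit [CharP k 3] in
/-- A matrix preserving `J` preserves the contraction: `c(A S Aᵀ) = c(S)`. [folklore] -/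
theorem csum_conj_eq {A : Matrix (Fin 3) (Fin 3) k} (hA : Aᵀ * JM * A = JM)
    (S : Matrix (Fin 3) (Fin 3) k) :
    (A * S * Aᵀ) 0 2 + (A * S * Aᵀ) 1 1 + (A * S * Aᵀ) 2 0 = S 0 2 + S 1 1 + S 2 0 := by
  rw [csum_eq_trace, csum_eq_trace]
  calc Matrix.trace (A * S * Aᵀ * JM) = Matrix.trace (A * (S * Aᵀ * JM)) := by
        simp only [Matrix.mul_assoc]
    _ = Matrix.trace (S * Aᵀ * JM * A) := by rw [Matrix.trace_mul_comm]
    _ = Matrix.trace (S * (Aᵀ * JM * A)) := by simp only [Matrix.mul_assoc]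
    _ = Matrix.trace (S * JM) := by rw [hA]

/-- The invariant propagated along `H = ⟨x, y⟩`: `g` and its Frobenius twist `g⁽³⁾` preserve the
form `J`, and `P` intertwines the twisted action of `g` on tensors of contraction zero with
conjugation by `g`, modulo `k · J`. [folklore] -/
def Good (g : Matrix (Fin 3) (Fin 3) k) : Prop :=
  gᵀ * JM * g = JM ∧ g * JM * gᵀ = JM ∧
    (g.map (frobenius k 3))ᵀ * JM * g.map (frobenius k 3) = JM ∧
    ∀ S : Matrix (Fin 3) (Fin 3) k, S 0 2 + S 1 1 + S 2 0 = 0 →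
      ∃ μ : k, P (g.map (frobenius k 3) * S * (g.map (frobenius k 3))ᵀ) = g * P S * gᵀ + μ • JM

/-- `Good x`. [folklore] -/
theorem good_xM : Good (xM : Matrix (Fin 3) (Fin 3) k) := by
  refine ⟨?_, ?_, ?_, fun S hS => ⟨S 0 1 + S 1 0 - S 2 2, ?_⟩⟩
  · rw [xM_transpose]; exact xMT_J_xM
  · rw [xM_transpose]; exact xM_J_xMT
  · rw [xM_map_frobenius, xM_transpose]; exact xMT_J_xM
  · rw [xM_map_frobenius, xM_transpose]; exact P_equivariant_x S hS

include hI in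
/-- `Good y`. [folklore] -/
theorem good_yM : Good (yM I : Matrix (Fin 3) (Fin 3) k) := by
  refine ⟨?_, ?_, ?_, fun S hS => ⟨I * S 0 0 + (1 + I) * (S 1 2 + S 2 1), ?_⟩⟩
  · rw [yM_transpose]; exact yMT_J_yM I hI
  · rw [yM_transpose]; exact yM_J_yMT I hI
  · rw [yM_map_frobenius I hI, y3M_transpose]; exact y3MT_J_y3M I hI
  · rw [yM_map_frobenius I hI, y3M_transpose, yM_transpose]; exact P_equivariant_y I hI S hS


/-- `Good 1`. [folklore] -/
theorem good_one : Good (1 : Matrix (Fin 3) (Fin 3) k) := by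
  have h1 : (1 : Matrix (Fin 3) (Fin 3) k).map (frobenius k 3) = 1 :=
    Matrix.map_one _ (map_zero _) (map_one _)
  refine ⟨by simp, by simp, by simp [h1], fun S _ => ⟨0, ?_⟩⟩
  simp [h1]


/-- `Good` is closed under products. [folklore] -/
theorem good_mul {g h : Matrix (Fin 3) (Fin 3) k} (hg : Good g) (hh : Good h) : Good (g * h) := by
  obtain ⟨hg1, hg2, hg3, hg4⟩ := hg
  obtain ⟨hh1, hh2, hh3, hh4⟩ := hh
  refine ⟨?_, ?_, ?_, fun S hS => ?_⟩
  · calc (g * h)ᵀ * JM * (g * h) = hᵀ * (gᵀ * JM * g) * h := by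
          rw [Matrix.transpose_mul]; simp only [Matrix.mul_assoc]
      _ = JM := by rw [hg1, hh1]
  · calc g * h * JM * (g * h)ᵀ = g * (h * JM * hᵀ) * gᵀ := by
          rw [Matrix.transpose_mul]; simp only [Matrix.mul_assoc]
      _ = JM := by rw [hh2, hg2]
  · rw [Matrix.map_mul]
    calc (g.map (frobenius k 3) * h.map (frobenius k 3))ᵀ * JM *
          (g.map (frobenius k 3) * h.map (frobenius k 3)) =
          (h.map (frobenius k 3))ᵀ * ((g.map (frobenius k 3))ᵀ * JM * g.map (frobenius k 3)) *
            h.map (frobenius k 3) := by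
          rw [Matrix.transpose_mul]; simp only [Matrix.mul_assoc]
      _ = JM := by rw [hg3, hh3]
  · -- equivariance: first `h` (on `S`), then `g` (on `h₃ S h₃ᵀ`, still of contraction zero)
    set S' : Matrix (Fin 3) (Fin 3) k := h.map (frobenius k 3) * S * (h.map (frobenius k 3))ᵀ
      with hS'
    have hS'0 : S' 0 2 + S' 1 1 + S' 2 0 = 0 := by rw [hS', csum_conj_eq hh3, hS]
    obtain ⟨μ₁, h1⟩ := hg4 S' hS'0
    obtain ⟨μ₂, h2⟩ := hh4 S hS
    refine ⟨μ₂ + μ₁, ?_⟩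
    have e1 : (g * h).map (frobenius k 3) * S * ((g * h).map (frobenius k 3))ᵀ =
        g.map (frobenius k 3) * S' * (g.map (frobenius k 3))ᵀ := by
      rw [Matrix.map_mul, Matrix.transpose_mul, hS']; simp only [Matrix.mul_assoc]
    rw [e1, h1, hS', h2, Matrix.transpose_mul, Matrix.mul_add, Matrix.add_mul, Matrix.mul_smul,
      Matrix.smul_mul, hg2, add_smul]
    simp only [Matrix.mul_assoc]
    abel

/-- Every element of `H = ⟨x, y⟩` is `Good` (closure induction; `x⁻¹ = x²`, `y⁻¹ = y²`). [folklore] -/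
theorem good_of_mem {g : GL (Fin 3) k} (hg : g ∈ H hI) : Good ((g : GL (Fin 3) k) : Matrix (Fin 3) (Fin 3) k) := by
  have hx3 : (x : GL (Fin 3) k) * (x * x) = 1 := by
    apply Units.ext
    simp only [Units.val_mul, Units.val_one, ← Matrix.mul_assoc]
    exact xM_cube
  have hy3 : (y hI : GL (Fin 3) k) * (y hI * y hI) = 1 := by
    apply Units.ext
    simp only [Units.val_mul, Units.val_one, ← Matrix.mul_assoc]
    exact yM_cube I hI
  induction hg using Subgroup.closure_induction'' with
  | mem z hz =>
    rcases hz with rfl | hz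
    · exact good_xM
    · rw [Set.mem_singleton_iff] at hz; subst hz; exact good_yM hI
  | inv_mem z hz =>
    rcases hz with rfl | hz
    · rw [inv_eq_of_mul_eq_one_right hx3, Units.val_mul]; exact good_mul good_xM good_xM
    · rw [Set.mem_singleton_iff] at hz; subst hz
      rw [inv_eq_of_mul_eq_one_right hy3, Units.val_mul]
      exact good_mul (good_yM hI) (good_yM hI)
  | one => simpa only [Units.val_one] using good_one
  | mul a b _ _ ha hb => rw [Units.val_mul]; exact good_mul ha hb

/-! ### The cocycle `g ↦ [P(g⁽³⁾ x₀ g⁽³⁾ᵀ − x₀) J] ∈ ad/Z` -/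

omit [CharP k 3] in
/-- `P` is additive. [folklore] -/
theorem P_add (A B : Matrix (Fin 3) (Fin 3) k) : P (A + B) = P A + P B := by
  refine mat3_eq ?_ ?_ ?_ ?_ ?_ ?_ ?_ ?_ ?_ <;>
    simp only [P, Matrix.add_apply, Matrix.of_apply, Matrix.cons_val', Matrix.cons_val_zero,
      Matrix.cons_val_one, Matrix.cons_val_two, Matrix.head_cons, Matrix.tail_cons] <;> ring

/-- The lift `F(g) := P(g⁽³⁾ x₀ (g⁽³⁾)ᵀ − x₀) · J ∈ M₃(k)` of the cocycle (`g⁽³⁾` the entrywise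
Frobenius twist). [folklore] -/
def Fl (g : GL (Fin 3) k) : Matrix (Fin 3) (Fin 3) k :=
  P (((g : GL (Fin 3) k) : Matrix (Fin 3) (Fin 3) k).map (frobenius k 3) * x0M *
      (((g : GL (Fin 3) k) : Matrix (Fin 3) (Fin 3) k).map (frobenius k 3))ᵀ - x0M) * JM

/-- `F(x)`. [folklore] -/
theorem Fl_x : Fl (x : GL (Fin 3) k) = FxM := by
  change P ((xM : Matrix (Fin 3) (Fin 3) k).map (frobenius k 3) * x0M *
    ((xM : Matrix (Fin 3) (Fin 3) k).map (frobenius k 3))ᵀ - x0M) * JM = FxM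
  rw [xM_map_frobenius, xM_transpose]
  exact Fx_eq

/-- `F(y)`. [folklore] -/
theorem Fl_y : Fl (y hI : GL (Fin 3) k) = FyM I := by
  change P ((yM I : Matrix (Fin 3) (Fin 3) k).map (frobenius k 3) * x0M *
    ((yM I : Matrix (Fin 3) (Fin 3) k).map (frobenius k 3))ᵀ - x0M) * JM = FyM I
  rw [yM_map_frobenius I hI, y3M_transpose]
  exact Fy_eq I hI

/-- **The twisted-coboundary identity**: for `Good` `g, h`,
`F(gh) = g F(h) g⁻¹ + F(g) + μ · 1` — so `g ↦ [F(g)]` is a `1`-cocycle with values in `ad/Z`.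
(`(gh)⁽³⁾ x₀ (gh)⁽³⁾ᵀ − x₀ = g⁽³⁾ (h⁽³⁾ x₀ h⁽³⁾ᵀ − x₀) g⁽³⁾ᵀ + (g⁽³⁾ x₀ g⁽³⁾ᵀ − x₀)`, the inner
tensor has contraction zero, `P` is equivariant on it modulo `k · J`, `J² = 1` and
`gᵀ J = J g⁻¹`.) [folklore] -/
theorem Fl_mul {g h : GL (Fin 3) k} (hg : Good ((g : GL (Fin 3) k) : Matrix (Fin 3) (Fin 3) k))
    (hh : Good ((h : GL (Fin 3) k) : Matrix (Fin 3) (Fin 3) k)) :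
    ∃ μ : k, Fl (g * h) = (g : Matrix (Fin 3) (Fin 3) k) * Fl h * ((g⁻¹ : GL (Fin 3) k) :
      Matrix (Fin 3) (Fin 3) k) + Fl g + μ • (1 : Matrix (Fin 3) (Fin 3) k) := by
  obtain ⟨hg1, hg2, -, hg4⟩ := hg
  obtain ⟨-, -, hh3, -⟩ := hh
  set g₃ : Matrix (Fin 3) (Fin 3) k := ((g : GL (Fin 3) k) : Matrix (Fin 3) (Fin 3) k).map
    (frobenius k 3) with hg₃
  set h₃ : Matrix (Fin 3) (Fin 3) k := ((h : GL (Fin 3) k) : Matrix (Fin 3) (Fin 3) k).map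
    (frobenius k 3) with hh₃
  set D : Matrix (Fin 3) (Fin 3) k := h₃ * x0M * h₃ᵀ - x0M with hD
  -- the inner tensor has contraction zero
  have hD0 : D 0 2 + D 1 1 + D 2 0 = 0 := by
    have h1 := csum_conj_eq hh3 x0M
    simp only [hD, Matrix.sub_apply]
    linear_combination h1
  obtain ⟨μ, hμ⟩ := hg4 D hD0
  refine ⟨μ, ?_⟩
  -- `gᵀ J = J g⁻¹`
  have hgT : ((g : GL (Fin 3) k) : Matrix (Fin 3) (Fin 3) k)ᵀ * JM =
      JM * ((g⁻¹ : GL (Fin 3) k) : Matrix (Fin 3) (Fin 3) k) := by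
    calc ((g : GL (Fin 3) k) : Matrix (Fin 3) (Fin 3) k)ᵀ * JM
        = ((g : GL (Fin 3) k) : Matrix (Fin 3) (Fin 3) k)ᵀ * JM *
            (((g : GL (Fin 3) k) : Matrix (Fin 3) (Fin 3) k) * ((g⁻¹ : GL (Fin 3) k) : Matrix _ _ k)) := by
          rw [← Units.val_mul, mul_inv_cancel, Units.val_one, Matrix.mul_one]
      _ = ((g : GL (Fin 3) k) : Matrix (Fin 3) (Fin 3) k)ᵀ * JM *
            ((g : GL (Fin 3) k) : Matrix (Fin 3) (Fin 3) k) *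
            ((g⁻¹ : GL (Fin 3) k) : Matrix _ _ k) := by simp only [Matrix.mul_assoc]
      _ = JM * ((g⁻¹ : GL (Fin 3) k) : Matrix _ _ k) := by rw [hg1]
  -- the decomposition of the twisted coboundary of `gh`
  have e2 : g₃ * h₃ * x0M * (g₃ * h₃)ᵀ - x0M = g₃ * D * g₃ᵀ + (g₃ * x0M * g₃ᵀ - x0M) := by
    rw [Matrix.transpose_mul, hD, Matrix.mul_sub, Matrix.sub_mul]
    simp only [Matrix.mul_assoc]
    abel
  change P ((((g * h : GL (Fin 3) k)) : Matrix (Fin 3) (Fin 3) k).map (frobenius k 3) * x0M *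
      ((((g * h : GL (Fin 3) k)) : Matrix (Fin 3) (Fin 3) k).map (frobenius k 3))ᵀ - x0M) * JM =
    ((g : GL (Fin 3) k) : Matrix (Fin 3) (Fin 3) k) * (P D * JM) *
        ((g⁻¹ : GL (Fin 3) k) : Matrix (Fin 3) (Fin 3) k) +
      P (g₃ * x0M * g₃ᵀ - x0M) * JM + μ • (1 : Matrix (Fin 3) (Fin 3) k)
  rw [Units.val_mul, Matrix.map_mul, ← hg₃, ← hh₃, e2, P_add, Matrix.add_mul, hμ, Matrix.add_mul,
    Matrix.smul_mul, JM_mul_JM, Matrix.mul_assoc (((g : GL (Fin 3) k) : Matrix (Fin 3) (Fin 3) k) * P D),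
    hgT]
  simp only [Matrix.mul_assoc]
  abel

/-- **The cocycle** `f : H → ad/Z`, `g ↦ [F(g)]`. [folklore] -/
def f (g : ↥(H hI)) : Matrix (Fin 3) (Fin 3) k ⧸ scalarMatrices (Fin 3) k :=
  Submodule.Quotient.mk (Fl (g : GL (Fin 3) k))

/-- `f` is a `1`-cocycle for `ad/Z = M₃(k)/k`. [folklore] -/
theorem f_cocycle (g h : ↥(H hI)) :
    f hI (g * h) = Subgroup.adModScalarRep (H hI) g (f hI h) + f hI g := by
  obtain ⟨μ, hμ⟩ := Fl_mul (good_of_mem hI g.2) (good_of_mem hI h.2)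
  have h0 : (Submodule.Quotient.mk (μ • (1 : Matrix (Fin 3) (Fin 3) k)) :
      Matrix (Fin 3) (Fin 3) k ⧸ scalarMatrices (Fin 3) k) = 0 :=
    (Submodule.Quotient.mk_eq_zero _).2 (smul_one_mem_scalarMatrices k μ)
  simp only [f, Subgroup.adModScalarRep_apply_mk, Subgroup.coe_mul]
  rw [hμ, Submodule.Quotient.mk_add, Submodule.Quotient.mk_add, h0, add_zero]

/-- **`f` is not a coboundary** (`key_not_coboundary`: the coboundary equations at `x` and `y` are
inconsistent). [folklore] -/
theorem f_not_coboundary :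
    ¬ ∃ m, ∀ g : ↥(H hI), f hI g = Subgroup.adModScalarRep (H hI) g m - m := by
  rintro ⟨m, hm⟩
  obtain ⟨Mt, rfl⟩ := Submodule.Quotient.mk_surjective (scalarMatrices (Fin 3) k) m
  have hxH : (x : GL (Fin 3) k) ∈ H hI := Subgroup.subset_closure (Set.mem_insert _ _)
  have hyH : (y hI : GL (Fin 3) k) ∈ H hI :=
    Subgroup.subset_closure (Set.mem_insert_of_mem _ rfl)
  have h1 := hm ⟨x, hxH⟩
  have h2 := hm ⟨y hI, hyH⟩
  simp only [f, Subgroup.adModScalarRep_apply_mk] at h1 h2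
  rw [Fl_x, ← Submodule.Quotient.mk_sub, Submodule.Quotient.eq] at h1
  rw [Fl_y, ← Submodule.Quotient.mk_sub, Submodule.Quotient.eq] at h2
  obtain ⟨c₁, hc₁⟩ := (mem_scalarMatrices_iff _).1 h1
  obtain ⟨c₂, hc₂⟩ := (mem_scalarMatrices_iff _).1 h2
  change c₁ • (1 : Matrix (Fin 3) (Fin 3) k) = FxM - (xM * Mt * xMinv - Mt) at hc₁
  change c₂ • (1 : Matrix (Fin 3) (Fin 3) k) = FyM I - (yM I * Mt * yMinv I - Mt) at hc₂
  have key := key_not_coboundary I hI Mt c₁ c₂ hc₁ hc₂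
  have h2' : (2 : k) = 0 := by linear_combination (-1 + I) * key + hI
  exact Sym4.two_ne_zero_of_charP_three h2'

/-- **`H = ⟨x, y⟩` is not adequate**: clause (ii) `H¹(H, ad/Z) = 0` fails.
[cite: GuralnickHerzigTiep2017, Corollary 9.4 (b) for `p = 3` and Theorem 1.7 (c)] -/
theorem not_isExtendedAdequate : ¬ Subgroup.IsExtendedAdequate (H hI) := fun hA =>
  f_not_coboundary hI (hA.exists_eq_sub_of_cocycle (f hI) (f_cocycle hI))

end Group

section Span

variable [CharP k 3] {I : k} (hI : I ^ 2 = -1)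

/-- **The matrices of `H = ⟨x, y⟩` span `M₃(k)`** (absolute irreducibility): each matrix unit is a
`k`-combination of the nine words `1 = x³, x, y, x², xy, yx, y², x²y, xy²` (coefficients found by
machine). [folklore] -/
theorem span_eq_top :
    Submodule.span k (Set.range fun g : ↥(H hI) => ((g : GL (Fin 3) k) : Matrix (Fin 3) (Fin 3) k)) = ⊤ := by
  set Sp := Submodule.span k (Set.range fun g : ↥(H hI) =>
    ((g : GL (Fin 3) k) : Matrix (Fin 3) (Fin 3) k)) with hSp
  have hxH : (x : GL (Fin 3) k) ∈ H hI := Subgroup.subset_closure (Set.mem_insert _ _)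
  have hyH : (y hI : GL (Fin 3) k) ∈ H hI := Subgroup.subset_closure (Set.mem_insert_of_mem _ rfl)
  have m_xxx : (xM * xM * xM : Matrix (Fin 3) (Fin 3) k) ∈ Sp :=
    Submodule.subset_span ⟨⟨x * x * x, mul_mem (mul_mem hxH hxH) hxH⟩, rfl⟩
  have m_x : (xM : Matrix (Fin 3) (Fin 3) k) ∈ Sp :=
    Submodule.subset_span ⟨⟨x, hxH⟩, rfl⟩
  have m_y : (yM I : Matrix (Fin 3) (Fin 3) k) ∈ Sp :=
    Submodule.subset_span ⟨⟨y hI, hyH⟩, rfl⟩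
  have m_xx : (xM * xM : Matrix (Fin 3) (Fin 3) k) ∈ Sp :=
    Submodule.subset_span ⟨⟨x * x, mul_mem hxH hxH⟩, rfl⟩
  have m_xy : (xM * yM I : Matrix (Fin 3) (Fin 3) k) ∈ Sp :=
    Submodule.subset_span ⟨⟨x * y hI, mul_mem hxH hyH⟩, rfl⟩
  have m_yx : (yM I * xM : Matrix (Fin 3) (Fin 3) k) ∈ Sp :=
    Submodule.subset_span ⟨⟨y hI * x, mul_mem hyH hxH⟩, rfl⟩
  have m_yy : (yM I * yM I : Matrix (Fin 3) (Fin 3) k) ∈ Sp :=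
    Submodule.subset_span ⟨⟨y hI * y hI, mul_mem hyH hyH⟩, rfl⟩
  have m_xxy : (xM * xM * yM I : Matrix (Fin 3) (Fin 3) k) ∈ Sp :=
    Submodule.subset_span ⟨⟨x * x * y hI, mul_mem (mul_mem hxH hxH) hyH⟩, rfl⟩
  have m_xyy : (xM * yM I * yM I : Matrix (Fin 3) (Fin 3) k) ∈ Sp :=
    Submodule.subset_span ⟨⟨x * y hI * y hI, mul_mem (mul_mem hxH hyH) hyH⟩, rfl⟩
  have s00 : Matrix.single (0 : Fin 3) (0 : Fin 3) (1 : k) ∈ Sp := by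
    have e : Matrix.single (0 : Fin 3) (0 : Fin 3) (1 : k) = !![1, 0, 0; 0, 0, 0; 0, 0, 0] := by
      ext i j; fin_cases i <;> fin_cases j <;> rfl
    rw [e, single_00_eq I hI]
    exact (Submodule.add_mem Sp (Submodule.add_mem Sp (Submodule.add_mem Sp (Submodule.add_mem Sp (Submodule.add_mem Sp (Submodule.add_mem Sp (Submodule.add_mem Sp (Submodule.add_mem Sp (Submodule.smul_mem Sp (((-1) + -(I)) : k) m_xxx) (Submodule.smul_mem Sp (((-1)) : k) m_x)) (Submodule.smul_mem Sp (((-1)) : k) m_y)) (Submodule.smul_mem Sp (((1) + I) : k) m_xx)) (Submodule.smul_mem Sp (((1) + I) : k) m_xy)) (Submodule.smul_mem Sp (((1) + I) : k) m_yx)) (Submodule.smul_mem Sp (((1) + I) : k) m_yy)) (Submodule.smul_mem Sp (((-1)) : k) m_xxy)) (Submodule.smul_mem Sp (((-1)) : k) m_xyy))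
  have s01 : Matrix.single (0 : Fin 3) (1 : Fin 3) (1 : k) ∈ Sp := by
    have e : Matrix.single (0 : Fin 3) (1 : Fin 3) (1 : k) = !![0, 1, 0; 0, 0, 0; 0, 0, 0] := by
      ext i j; fin_cases i <;> fin_cases j <;> rfl
    rw [e, single_01_eq I hI]
    exact (Submodule.add_mem Sp (Submodule.add_mem Sp (Submodule.add_mem Sp (Submodule.add_mem Sp (Submodule.add_mem Sp (Submodule.add_mem Sp (Submodule.add_mem Sp (Submodule.add_mem Sp (Submodule.smul_mem Sp (((-1)) : k) m_xxx) (Submodule.smul_mem Sp ((-(I)) : k) m_x)) (Submodule.smul_mem Sp (((-1)) : k) m_y)) (Submodule.smul_mem Sp (((-1) + -(I)) : k) m_xx)) (Submodule.smul_mem Sp (((1)) : k) m_xy)) (Submodule.smul_mem Sp ((I) : k) m_yx)) (Submodule.smul_mem Sp ((I) : k) m_yy)) (Submodule.smul_mem Sp (((-1)) : k) m_xxy)) (Submodule.smul_mem Sp (((1) + I) : k) m_xyy))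
  have s02 : Matrix.single (0 : Fin 3) (2 : Fin 3) (1 : k) ∈ Sp := by
    have e : Matrix.single (0 : Fin 3) (2 : Fin 3) (1 : k) = !![0, 0, 1; 0, 0, 0; 0, 0, 0] := by
      ext i j; fin_cases i <;> fin_cases j <;> rfl
    rw [e, single_02_eq ]
    exact (Submodule.add_mem Sp (Submodule.add_mem Sp (Submodule.smul_mem Sp (((-1)) : k) m_xxx) (Submodule.smul_mem Sp (((-1)) : k) m_x)) (Submodule.smul_mem Sp (((-1)) : k) m_xx))
  have s10 : Matrix.single (1 : Fin 3) (0 : Fin 3) (1 : k) ∈ Sp := by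
    have e : Matrix.single (1 : Fin 3) (0 : Fin 3) (1 : k) = !![0, 0, 0; 1, 0, 0; 0, 0, 0] := by
      ext i j; fin_cases i <;> fin_cases j <;> rfl
    rw [e, single_10_eq I hI]
    exact (Submodule.add_mem Sp (Submodule.add_mem Sp (Submodule.add_mem Sp (Submodule.add_mem Sp (Submodule.add_mem Sp (Submodule.add_mem Sp (Submodule.add_mem Sp (Submodule.add_mem Sp (Submodule.smul_mem Sp (((-1) + I) : k) m_xxx) (Submodule.smul_mem Sp (((-1) + I) : k) m_x)) (Submodule.smul_mem Sp (((-1) + -(I)) : k) m_y)) (Submodule.smul_mem Sp (((1) + I) : k) m_xx)) (Submodule.smul_mem Sp (((1) + -(I)) : k) m_xy)) (Submodule.smul_mem Sp (((1) + I) : k) m_yx)) (Submodule.smul_mem Sp (((1)) : k) m_yy)) (Submodule.smul_mem Sp (((-1)) : k) m_xxy)) (Submodule.smul_mem Sp (((-1) + I) : k) m_xyy))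
  have s11 : Matrix.single (1 : Fin 3) (1 : Fin 3) (1 : k) ∈ Sp := by
    have e : Matrix.single (1 : Fin 3) (1 : Fin 3) (1 : k) = !![0, 0, 0; 0, 1, 0; 0, 0, 0] := by
      ext i j; fin_cases i <;> fin_cases j <;> rfl
    rw [e, single_11_eq I hI]
    exact (Submodule.add_mem Sp (Submodule.add_mem Sp (Submodule.add_mem Sp (Submodule.add_mem Sp (Submodule.add_mem Sp (Submodule.add_mem Sp (Submodule.smul_mem Sp ((I) : k) m_xxx) (Submodule.smul_mem Sp (((1) + -(I)) : k) m_x)) (Submodule.smul_mem Sp (((1) + -(I)) : k) m_y)) (Submodule.smul_mem Sp (((1) + I) : k) m_xx)) (Submodule.smul_mem Sp (((-1)) : k) m_xy)) (Submodule.smul_mem Sp (((-1)) : k) m_yx)) (Submodule.smul_mem Sp (((1) + I) : k) m_yy))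
  have s12 : Matrix.single (1 : Fin 3) (2 : Fin 3) (1 : k) ∈ Sp := by
    have e : Matrix.single (1 : Fin 3) (2 : Fin 3) (1 : k) = !![0, 0, 0; 0, 0, 1; 0, 0, 0] := by
      ext i j; fin_cases i <;> fin_cases j <;> rfl
    rw [e, single_12_eq I hI]
    exact (Submodule.add_mem Sp (Submodule.add_mem Sp (Submodule.add_mem Sp (Submodule.add_mem Sp (Submodule.add_mem Sp (Submodule.add_mem Sp (Submodule.add_mem Sp (Submodule.add_mem Sp (Submodule.smul_mem Sp (((-1)) : k) m_xxx) (Submodule.smul_mem Sp (((1) + -(I)) : k) m_x)) (Submodule.smul_mem Sp (((-1)) : k) m_y)) (Submodule.smul_mem Sp (((1) + -(I)) : k) m_xx)) (Submodule.smul_mem Sp (((1)) : k) m_xy)) (Submodule.smul_mem Sp ((I) : k) m_yx)) (Submodule.smul_mem Sp ((I) : k) m_yy)) (Submodule.smul_mem Sp (((-1)) : k) m_xxy)) (Submodule.smul_mem Sp (((1) + I) : k) m_xyy))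
  have s20 : Matrix.single (2 : Fin 3) (0 : Fin 3) (1 : k) ∈ Sp := by
    have e : Matrix.single (2 : Fin 3) (0 : Fin 3) (1 : k) = !![0, 0, 0; 0, 0, 0; 1, 0, 0] := by
      ext i j; fin_cases i <;> fin_cases j <;> rfl
    rw [e, single_20_eq I hI]
    exact (Submodule.add_mem Sp (Submodule.add_mem Sp (Submodule.smul_mem Sp ((-(I)) : k) m_xxx) (Submodule.smul_mem Sp ((-(I)) : k) m_y)) (Submodule.smul_mem Sp ((-(I)) : k) m_yy))
  have s21 : Matrix.single (2 : Fin 3) (1 : Fin 3) (1 : k) ∈ Sp := by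
    have e : Matrix.single (2 : Fin 3) (1 : Fin 3) (1 : k) = !![0, 0, 0; 0, 0, 0; 0, 1, 0] := by
      ext i j; fin_cases i <;> fin_cases j <;> rfl
    rw [e, single_21_eq I hI]
    exact (Submodule.add_mem Sp (Submodule.add_mem Sp (Submodule.add_mem Sp (Submodule.add_mem Sp (Submodule.add_mem Sp (Submodule.add_mem Sp (Submodule.add_mem Sp (Submodule.add_mem Sp (Submodule.smul_mem Sp (((-1) + I) : k) m_xxx) (Submodule.smul_mem Sp (((-1) + I) : k) m_x)) (Submodule.smul_mem Sp ((I) : k) m_y)) (Submodule.smul_mem Sp (((1) + I) : k) m_xx)) (Submodule.smul_mem Sp (((1) + -(I)) : k) m_xy)) (Submodule.smul_mem Sp (((1) + I) : k) m_yx)) (Submodule.smul_mem Sp ((I) : k) m_yy)) (Submodule.smul_mem Sp (((-1)) : k) m_xxy)) (Submodule.smul_mem Sp (((-1) + I) : k) m_xyy))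
  have s22 : Matrix.single (2 : Fin 3) (2 : Fin 3) (1 : k) ∈ Sp := by
    have e : Matrix.single (2 : Fin 3) (2 : Fin 3) (1 : k) = !![0, 0, 0; 0, 0, 0; 0, 0, 1] := by
      ext i j; fin_cases i <;> fin_cases j <;> rfl
    rw [e, single_22_eq I hI]
    exact (Submodule.add_mem Sp (Submodule.add_mem Sp (Submodule.add_mem Sp (Submodule.add_mem Sp (Submodule.add_mem Sp (Submodule.add_mem Sp (Submodule.add_mem Sp (Submodule.add_mem Sp (Submodule.smul_mem Sp (((-1)) : k) m_xxx) (Submodule.smul_mem Sp ((I) : k) m_x)) (Submodule.smul_mem Sp ((I) : k) m_y)) (Submodule.smul_mem Sp (((1) + I) : k) m_xx)) (Submodule.smul_mem Sp ((-(I)) : k) m_xy)) (Submodule.smul_mem Sp ((-(I)) : k) m_yx)) (Submodule.smul_mem Sp (((1) + I) : k) m_yy)) (Submodule.smul_mem Sp (((1)) : k) m_xxy)) (Submodule.smul_mem Sp (((1)) : k) m_xyy))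
  rw [eq_top_iff]
  rintro M -
  rw [Matrix.matrix_eq_sum_single M]
  refine Submodule.sum_mem _ fun i _ => Submodule.sum_mem _ fun j _ => ?_
  have e : Matrix.single i j (M i j) = M i j • Matrix.single i j (1 : k) := by
    rw [Matrix.smul_single, smul_eq_mul, mul_one]
  rw [e]
  refine Submodule.smul_mem _ _ ?_
  fin_cases i <;> fin_cases j
  · exact s00
  · exact s01
  · exact s02
  · exact s10
  · exact s11
  · exact s12
  · exact s20
  · exact s21
  · exact s22

end Span
section Consequences

variable [CharP k 3] {I : k} (hI : I ^ 2 = -1)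

/-- **`H` is absolutely irreducible on `k³`** (its matrices span `M₃(k)`, Burnside).
[folklore] -/
theorem isAbsIrreducible : IsAbsIrreducible (H hI).subtype :=
  (Literature.RepresentationTheory.Semisimple.span_eq_top_iff_forall_isIrreducible
    (by norm_num) (H hI).subtype).1 (span_eq_top hI)

/-- **`H` has no abelian normal subgroup of index `3`**: `xy` and `yx` have order dividing `4`, so
both would lie in such a subgroup (`mem_of_coprime_orderOf_of_index_eq`), but they do not commute.
(Over `𝔽₉`, `H ≅ A₆` is simple.) [folklore] -/
theorem not_exists_comm_normal_index :
    ¬ ∃ A : Subgroup ↥(H hI), A.Normal ∧ (∀ a ∈ A, ∀ b ∈ A, a * b = b * a) ∧ A.index = 3 := by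
  rintro ⟨A, hAn, hcomm, hidx⟩
  have hxH : (x : GL (Fin 3) k) ∈ H hI := Subgroup.subset_closure (Set.mem_insert _ _)
  have hyH : (y hI : GL (Fin 3) k) ∈ H hI :=
    Subgroup.subset_closure (Set.mem_insert_of_mem _ rfl)
  -- `(xy)⁴ = 1 = (yx)⁴`
  have h4 : ∀ {M N : Matrix (Fin 3) (Fin 3) k}, M * M = N → N * N = 1 → M ^ 4 = 1 := by
    intro M N h1 h2
    rw [show (4 : ℕ) = 2 * 2 from rfl, pow_mul, sq, sq, h1, h2]
  have hxy4 : ((⟨x * y hI, mul_mem hxH hyH⟩ : ↥(H hI)) : ↥(H hI)) ^ 4 = 1 := by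
    apply Subtype.ext; apply Units.ext
    simp only [SubmonoidClass.mk_pow, Units.val_pow_eq_pow_val, Units.val_mul, OneMemClass.coe_one,
      Units.val_one]
    change (xM * yM I : Matrix (Fin 3) (Fin 3) k) ^ 4 = 1
    rw [xM_mul_yM I]
    exact h4 (xyM_sq I hI) (xy2M_sq I hI)
  have hyx4 : ((⟨y hI * x, mul_mem hyH hxH⟩ : ↥(H hI)) : ↥(H hI)) ^ 4 = 1 := by
    apply Subtype.ext; apply Units.ext
    simp only [SubmonoidClass.mk_pow, Units.val_pow_eq_pow_val, Units.val_mul, OneMemClass.coe_one,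
      Units.val_one]
    change (yM I * xM : Matrix (Fin 3) (Fin 3) k) ^ 4 = 1
    rw [yM_mul_xM I]
    exact h4 (yxM_sq I hI) (yx2M_sq I hI)
  have hcop : ∀ {g : ↥(H hI)}, g ^ 4 = 1 → (orderOf g).Coprime 3 := fun hg =>
    Nat.Coprime.coprime_dvd_left (orderOf_dvd_of_pow_eq_one hg) (by norm_num)
  have hm1 := mem_of_coprime_orderOf_of_index_eq Nat.prime_three hidx (hcop hxy4)
  have hm2 := mem_of_coprime_orderOf_of_index_eq Nat.prime_three hidx (hcop hyx4)
  have hc := hcomm _ hm1 _ hm2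
  have hmat := congrArg (fun g : ↥(H hI) => ((g : GL (Fin 3) k) : Matrix (Fin 3) (Fin 3) k)) hc
  simp only [Subgroup.coe_mul, Units.val_mul] at hmat
  change xM * yM I * (yM I * xM) = yM I * xM * (xM * yM I) at hmat
  rw [xM_mul_yM I, yM_mul_xM I] at hmat
  exact Sym4.two_ne_zero_of_charP_three (two_eq_zero_of_xyM_comm I hI hmat)

end Consequences

/-! ### Over `𝔽₉`: the counterexample to "(a) or (b)" in degree `p = 3` -/

section FiniteField

/-- `𝔽₉ = GaloisField 3 2` contains a square root of `-1` (`9 ≡ 1 mod 4`). [folklore] -/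
theorem exists_sq_eq_neg_one : ∃ I : GaloisField 3 2, I ^ 2 = -1 := by
  letI : Fintype (GaloisField 3 2) := Fintype.ofFinite _
  have hcard : Fintype.card (GaloisField 3 2) = 9 := by
    rw [← Nat.card_eq_fintype_card, GaloisField.card 3 2 (by norm_num)]; norm_num
  obtain ⟨r, hr⟩ := FiniteField.isSquare_neg_one_iff.2 (by rw [hcard]; norm_num)
  exact ⟨r, by rw [sq]; exact hr.symm⟩

/-- **Alternative (c) of GHT Theorem 1.7 cannot be dropped.**  It is NOT true that for every field
`k` of characteristic `3` and every faithful absolutely irreducible `σ : G → GL₃(k)` of a finite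
group, either `σ(G)` is adequate or `G` has an abelian normal subgroup of index `3`: the subgroup
`H = ⟨x, y⟩ ≅ Ω₃(9) ≅ PSL₂(9) ≅ A₆` of `GL₃(𝔽₉)` (the symmetric square of `SL₂(9)`) is absolutely
irreducible, has no abelian normal subgroup of index `3`, and `H¹(H, ad/Z) ≠ 0` — the exceptional
case `p = 3`, "the image of `G` in `PGL₃` is `PSL₂(9)`", of the printed theorem, where
`dim H¹(PSL₂(9), ad/Z) = 1` [GHT Cor. 9.4 (b)].  Proved here without the classification and
without character tables, by explicit `3 × 3` matrices over `𝔽₃(i)` and a machine-found cocycle.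
[cite: GuralnickHerzigTiep2017, Theorem 1.7 (c), Theorem 6.15 (proof for `p = 3`, p. 24) and Corollary 9.4 (b)] -/
theorem not_forall_adequate_or_comm_normal_index_three :
    ¬ ∀ (k : Type) [Field k] [CharP k 3] (G : Type) [Group G] [Finite G] (σ : G →* GL (Fin 3) k),
        Function.Injective σ → IsAbsIrreducible σ →
          Subgroup.IsExtendedAdequate σ.range ∨
            ∃ A : Subgroup G, A.Normal ∧ (∀ a ∈ A, ∀ b ∈ A, a * b = b * a) ∧ A.index = 3 := by
  intro h
  obtain ⟨I, hI⟩ := exists_sq_eq_neg_one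
  haveI : Finite (GL (Fin 3) (GaloisField 3 2)) := Finite.of_injective _ Units.val_injective
  have h1 := h (GaloisField 3 2) ↥(H hI) (H hI).subtype (H hI).subtype_injective
    (isAbsIrreducible hI)
  rw [Subgroup.range_subtype] at h1
  rcases h1 with ha | hb
  · exact not_isExtendedAdequate hI ha
  · exact not_exists_comm_normal_index hI hb

/-- The same, in the shape of the named fact `ght2017_adequate_or_index_p_or_psl29` with its third
alternative deleted: that weakened dichotomy is FALSE (at `p = 3`, universe `0`).
[cite: GuralnickHerzigTiep2017, Theorem 1.7 (c)] -/
theorem not_forall_adequate_or_comm_normal_index :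
    ¬ ∀ (p : ℕ) [Fact p.Prime] (k : Type) [Field k] [CharP k p] (G : Type) [Group G] [Finite G]
        (σ : G →* GL (Fin p) k), Function.Injective σ → IsAbsIrreducible σ →
          Subgroup.IsExtendedAdequate σ.range ∨
            ∃ A : Subgroup G, A.Normal ∧ (∀ a ∈ A, ∀ b ∈ A, a * b = b * a) ∧ A.index = p :=
  fun h => not_forall_adequate_or_comm_normal_index_three (h 3)

end FiniteField


end OmegaThreeNine

end Literature.NumberTheory.GaloisRepresentations
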